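import Literature.NumberTheory.Sieve.FriedlanderIwaniecPrimesBilinearForm
import Literature.NumberTheory.Sieve.FriedlanderIwaniecPrimesBilinearCounting
import Literature.NumberTheory.Sieve.FriedlanderIwaniecPrimesBilinearPartition
import HarnessLib

/-!
# Friedlander–Iwaniec, *The polynomial `X² + Y⁴` captures its primes*: Proposition 4.1 from (4.23)

Family `parity`, statement parity.S17 (`setOf_prime_sq_add_pow_four_infinite`). Source: J. Friedlander,
H. Iwaniec, Ann. of Math. (2) 148 (1998), 945–1040 [FriedlanderIwaniecAnnals1998], §4 "The bilinear
form in the sieve: Refinements", (4.3)–(4.23).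

**Main result.** `FriedlanderIwaniec1998_prop41_of_bilinear423`: the bound (4.23) for the
forms `B*(M, N)` of (4.20) (`fiBilinearStar`, `FriedlanderIwaniecPrimesBilinearForm`) — taken as
the explicit HYPOTHESIS `h` of the theorem, in the shape `BilinBoundAt` of this file — implies the
named fact `FriedlanderIwaniec1998_prop41` (Proposition 4.1, `FriedlanderIwaniecPrimes`). This is
the reduction carried out in §4 of the source, PROVED here in full. (4.23) itself is proved in
§§5–26 of the source (Hecke `L`-functions of `ℚ(i)` with Siegel-type bounds, lattice points in the
biquadratic ellipse, Jacobi–Kubota symbols) and is NOT vendored as a separate named fact: it is a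
waypoint inside the proof of Proposition 4.1, which stays the one cited fact of the tree for
FI §§4–26 (D-0026 review 2026-08-15: the former `def FriedlanderIwaniec1998_bilinear423` was merged
back into this hypothesis).

**The hypothesis `h` ((4.23) as used by §4).** For every `η > 0` and `A > 0` there are
`A' ≥ 2A + 2^20` (the exponent of (4.15) `θ = (log x)^{-A'}`; (10.12), §18), `t ≥ A + 124` (the
exponent of `τ = (log x)^t`, (4.11)), `B > 0` and `K > 0` such that for all large `x`, all `P` in
(4.4) `(log log x)² ≤ log P ≤ (log x)(log log x)⁻²`, all `N` in (4.6)
`x^{1/4+η} < N < x^{1/2}(log x)^{-B}` and all `C` with `1 ≤ C ≤ N^{1-η}`: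
`BilinBoundAt x P N C (2A+8) θ τ ϑ K`, i.e. for all `M` with `x(log x)^{-2A-8} < MN < x`, all
`N < N' < 2N`, every `C²` function `p` vanishing off `(N', (1+θ)N']` with (4.14) `|p| ≤ 1`,
`|p'| ≤ (θN)⁻¹`, `|p''| ≤ (θN)⁻²`, and all complex `|α(m)| ≤ 1`,
`‖B*(M, N)‖ ≤ K ϑ θ (MN)^{3/4} (log MN)⁴`, `ϑ = (log x)^{-A}` (4.16). This is (4.23) as printed
("It now suffices to show that for every `N` satisfying (4.6) and `MN` satisfying (4.19) we have
(4.23) `B*(M, N) ≪ ϑθ(MN)^{3/4}(log MN)^4`", the parameters being fixed only in §18: "we may for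
example take `A' = 2A + 2^20` and `τ = (log x)^{A+2^20}`. If we take `B` sufficiently large we then
ensure the remaining conditions (5.11) and (9.12)") with ONE deviation: the range of `MN` is
`x(log x)^{-2A-8} < MN < x` instead of (4.19) `ϑx < MN < x`. The printed remark that the terms with
`m ≤ ϑxN⁻¹` are "absorbed by the bound (4.17)" is not literally right — estimated trivially with
(4.2) they contribute `≍ ϑ^{3/4} θ A(x)(log x)^{O(1)}` to each smoothed form, which is not
`O(ϑθA(x)(log x)^4)` once `A` is large (and (4.7) needs `A = 2^26 + 4`) — so the reduction needs
(4.23) down to `MN > x(log x)^{-2A-8}`. This is within what §§5–18 prove: the lower bound for `MN`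
enters there only through (5.11) `N ≤ ϑθ√(MN)`, "`M ≥ N`" (§4) and (9.12) (`M/N ≥ ϑ(log x)^{2B}`),
each met by taking `B` larger, exactly as the printed `B = B(η, A)` absorbs (4.19).

## The argument (§4 of the source, made quantitative)

For `x` large, `P` in (4.4), `N` in (4.6) (with `B = max(B₀, A + 10)`, `B₀` from (4.23)) and
`1 ≤ C ≤ N^{1-η}`, write `B(x; N) = Σ_m |Σ_{n ∈ F(m)} w₀(n) a_{mn}|`, `w₀ = μ γ(·, C)`
(`fiBilinearPi_eq`; `F(m)` = `fiRangeF`, the conditions `N < n ≤ 2N`, `mn ≤ x`, `(n, mΠ) = 1`).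
With `θ = (log x)^{-A'}`, `τ = (log x)^t`, `ϑ = (log x)^{-A}` (`A', t` from (4.23)):

1. (4.9)–(4.10) `w₀ = w_{≤τ} + w_{>τ}` (`fiWle`, `fiWgt`); the part `τ(n) > τ` costs
   `τ⁻¹ Σ_{n sqfree} τ(n)² A_n(x) ≪ τ⁻¹ x^{3/4} (log x)^{16}` (`sum_abs_fiWSum_fiWgt_le`,
   `sum_pow_mul_congrSum_le`), admissible since `t ≥ A + 124`.
2. (4.12)–(4.15) `w_{≤τ} = Σ_{k<K'} p_k w_{≤τ} + r w_{≤τ}` with the explicit partition of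
   `FriedlanderIwaniecPrimesBilinearPartition`; the residual `r` lives on `2θN + 2` integers near `N`
   and `2N` and costs, by Cauchy–Schwarz and `Σ τ⁴ ≪ N (log x)^{32}`, `≪ θ^{1/2} x^{3/4} (log x)^{16}`
   (`sum_abs_fiWSum_residual_le`, `sum_zone_congrSum_le`), admissible since `A' ≥ 2A + 2^20`.
3. For each piece, the cutoff `mn ≤ x` is automatic when `m(u_k + θN) ≤ x` and otherwise every
   term has `x(1-θ) < mn ≤ x` (`abs_fiWSum_piece_le`); summed over `k` (`Σ_k p_k ≤ 1`) these boundary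
   terms cost `Σ τ(n)(A_n(x) - A_n(x(1-θ))) ≪ (θ x^{3/4} + √x)(log x)^8 + x^{1/4} N (log x)^8`
   (`sum_shell_le`, `sum_mul_congrSum_sub_le`, shell count of `…BilinearCounting`).
4. (4.18)–(4.23) the remaining `m ≤ x/(u_k + θN)` are split dyadically (`sum_Icc_floor_eq_dyadic`);
   a block `M < m ≤ 2M` with `MN > x(log x)^{-2A-8}` IS a form `B*(M, N)` with `α(m) = sign`,
   `N' = u_k`, `p = p_k/(8M_ψ)` (`inner_eq_fiWSum`, `sum_sign_mul_eq`, `sum_abs_block_le`), so (4.23)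
   bounds it by `8M_ψ K₀ ϑ θ (MN)^{3/4} (log x)⁴`; the blocks add up geometrically
   (`sum_range_dyadic_rpow_le`) and the `K' ≤ 2/θ` pieces give `48 M_ψ K₀ ϑ x^{3/4}(log x)⁴`
   (`sum_pieces_main_le`); the blocks below `x(log x)^{-2A-8}` are estimated trivially
   (`sum_small_le`), `≪ x^{3/4} (log x)^{8 - (3/4)(2A+7)} + …`. (The source's range (4.19)
   `MN > ϑx` does not suffice here, see "The hypothesis `h`" above.)
5. `fiBilinearPi_le_master` collects 1–4 at fixed `x`; `err1_le` … `err4_le` and the elementary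
   asymptotics `eventually_mul_log_rpow_le`, `eventually_mul_log_rpow_le_rpow` compare every error
   term with `x^{3/4}(log x)^{4-A} ≤ A(x)(log x)^{4-A}/(2κ)` ((4.2), `fiCount_bounds`).

## Contents

* `fiRangeF`, `fiRangeG`, `fiWSum`, `fiW0`, `fiWle`, `fiWgt`, `pouResidual`, `BilinBoundAt`
  (auxiliary definitions: index ranges, weighted inner sums, the weights, (4.23) at a point);
* the lemmas named above, and `FriedlanderIwaniec1998_prop41_of_bilinear423`.

## References

* J. Friedlander, H. Iwaniec, *The polynomial `X² + Y⁴` captures its primes*, Ann. of Math. (2)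
  148 (1998), 945–1040, §4 (4.3)–(4.23), §18. [FriedlanderIwaniecAnnals1998]

## Tree

`fiBeta`, `fiBilinearStar` (`…BilinearForm`);
`congrSum_le_of_squarefree`, `congrSum_sub_le_of_squarefree`, `sum_fiRepCount_mul_le_congrSum_sub`,
`fiCount_le_rpow`, `fiCount_sub_thin_le`, `sum_sigma_zero_sq_le_sqrt_card` (`…BilinearCounting`);
`pouPiece`, `pouNode`, `pouCount`, `sum_pouPiece_mem_Icc`, `residual_zone`, `abs_deriv_pouPiece_le`,
`exists_bound_deriv_smoothTransition` (`…BilinearPartition`); `exists_sum_sigma_zero_pow_le_real`,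
`exists_sum_sigma_zero_pow_div_le_real` (`DivisorPowerSums`); `fiCount_bounds`,
`FriedlanderIwaniec1998_count_asymp_holds`, `SieveSequence.fiBilinearPi` (`FriedlanderIwaniecPrimes`).
Mathlib: `exists_nat_pow_near`, `isLittleO_log_rpow_rpow_atTop`, `tendsto_rpow_atTop`,
`geom_sum_Ico_le_of_lt_one`.
-/

noncomputable section

open Filter Finset Real
open scoped ArithmeticFunction.Moebius ArithmeticFunction.sigma

namespace Literature.NumberTheory.Sieve

namespace FriedlanderIwaniecPrimes

/-! ### The inner sums of `B(x; N)` and their weights -/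

/-- The `n`-range of the inner sum of `B(x; N)` (4.3) at `m`: `N < n ≤ 2N`, `mn ≤ x`, `(n, m) = 1`,
`(n, Π) = 1`. [cite: FriedlanderIwaniecAnnals1998, (4.3)] -/
def fiRangeF (x N P : ℝ) (m : ℕ) : Finset ℕ :=
  (Ioc ⌊N⌋₊ ⌊2 * N⌋₊).filter
    (fun n : ℕ => ((m * n : ℕ) : ℝ) ≤ x ∧ n.Coprime m ∧ ∀ p ∈ n.primeFactors, P ≤ (p : ℝ))

/-- The same range without the cutoff `mn ≤ x` (the inner range of the forms `B*(M, N)`).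
[cite: FriedlanderIwaniecAnnals1998, (4.20)] -/
def fiRangeG (N P : ℝ) (m : ℕ) : Finset ℕ :=
  (Ioc ⌊N⌋₊ ⌊2 * N⌋₊).filter (fun n : ℕ => n.Coprime m ∧ ∀ p ∈ n.primeFactors, P ≤ (p : ℝ))

/-- A weighted inner sum `Σ_{n ∈ S} w(n) a_{mn}`. [folklore] -/
def fiWSum (S : Finset ℕ) (w : ℕ → ℝ) (m : ℕ) : ℝ := ∑ n ∈ S, w n * (fiRepCount (m * n) : ℝ)

/-- The sieve weights `w₀(n) = μ(n) γ(n, C)` of (2.12). [cite: FriedlanderIwaniecAnnals1998, (2.12)] -/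
def fiW0 (C : ℝ) (n : ℕ) : ℝ := (μ n : ℝ) * (SieveSequence.fiGamma C n : ℝ)

/-- `w₀` restricted to `τ(n) ≤ τ` ((4.9)). [cite: FriedlanderIwaniecAnnals1998, (4.9)] -/
def fiWle (C τ : ℝ) (n : ℕ) : ℝ := if ((σ 0 n : ℕ) : ℝ) ≤ τ then fiW0 C n else 0

/-- `w₀` restricted to `τ(n) > τ` (the complementary sum of (4.10)). [cite: FriedlanderIwaniecAnnals1998, (4.10)] -/
def fiWgt (C τ : ℝ) (n : ℕ) : ℝ := if ((σ 0 n : ℕ) : ℝ) ≤ τ then 0 else fiW0 C n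

/-- `F(m) ⊆ G(m)`. [folklore] -/
theorem fiRangeF_subset (x N P : ℝ) (m : ℕ) : fiRangeF x N P m ⊆ fiRangeG N P m := by
  intro n hn
  rw [fiRangeF, mem_filter] at hn
  exact mem_filter.mpr ⟨hn.1, hn.2.2⟩

/-- `G(m) ⊆ (⌊N⌋, ⌊2N⌋]`. [folklore] -/
theorem fiRangeG_subset (N P : ℝ) (m : ℕ) : fiRangeG N P m ⊆ Ioc ⌊N⌋₊ ⌊2 * N⌋₊ := filter_subset _ _

/-- `F(m)` is `G(m)` cut by `mn ≤ x`. [folklore] -/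
theorem fiRangeF_eq_filter (x N P : ℝ) (m : ℕ) :
    fiRangeF x N P m = (fiRangeG N P m).filter (fun n : ℕ => ((m * n : ℕ) : ℝ) ≤ x) := by
  ext n
  simp only [fiRangeF, fiRangeG, mem_filter]
  tauto

/-- `B(x; N) = Σ_m |Σ_{n ∈ F(m)} w₀(n) a_{mn}|`. [cite: FriedlanderIwaniecAnnals1998, (4.3)] -/
theorem fiBilinearPi_eq (x N C P : ℝ) :
    fiSieveSeq.fiBilinearPi x N C P = ∑ m ∈ Icc 1 ⌊x⌋₊, |fiWSum (fiRangeF x N P m) (fiW0 C) m| :=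
  rfl

/-- `w₀ = w_{≤τ} + w_{>τ}`. [folklore] -/
theorem fiW0_add (C τ : ℝ) (n : ℕ) : fiW0 C n = fiWle C τ n + fiWgt C τ n := by
  unfold fiWle fiWgt; split_ifs <;> simp

/-- `|w₀(n)| ≤ τ(n)`, and `w₀(n) = 0` unless `n` is squarefree. [folklore] -/
theorem abs_fiW0_le (C : ℝ) (n : ℕ) :
    |fiW0 C n| ≤ if Squarefree n then ((σ 0 n : ℕ) : ℝ) else 0 := by
  unfold fiW0
  split_ifs with h
  · rw [abs_mul]
    have hμ : |(μ n : ℝ)| ≤ 1 := by exact_mod_cast ArithmeticFunction.abs_moebius_le_one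
    have hγ : |(SieveSequence.fiGamma C n : ℝ)| ≤ (σ 0 n : ℕ) := by
      have h := SieveSequence.abs_fiGamma_le C n
      have h' : ((|SieveSequence.fiGamma C n| : ℤ) : ℝ) ≤ ((σ 0 n : ℕ) : ℤ) := by exact_mod_cast h
      simpa [Int.cast_abs] using h'
    calc |(μ n : ℝ)| * |(SieveSequence.fiGamma C n : ℝ)| ≤ 1 * (σ 0 n : ℕ) := by gcongr
      _ = _ := one_mul _
  · rw [ArithmeticFunction.moebius_eq_zero_of_not_squarefree h]; simp

/-- `|w_{≤τ}(n)| ≤ τ(n)` on squarefree `n`, `0` elsewhere. [folklore] -/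
theorem abs_fiWle_le (C τ : ℝ) (n : ℕ) :
    |fiWle C τ n| ≤ if Squarefree n then ((σ 0 n : ℕ) : ℝ) else 0 := by
  unfold fiWle
  split_ifs with h1 h2 h2 <;> first | exact (abs_fiW0_le C n).trans (by simp [h2]) | simp

/-- `|w_{>τ}(n)| ≤ τ(n)²/τ` on squarefree `n`, `0` elsewhere (the device of (4.10)). [folklore] -/
theorem abs_fiWgt_le {C τ : ℝ} (hτ : 0 < τ) (n : ℕ) :
    |fiWgt C τ n| ≤ if Squarefree n then ((σ 0 n : ℕ) : ℝ) ^ 2 / τ else 0 := by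
  unfold fiWgt
  split_ifs with h1 h2 h2
  · simp; positivity
  · simp
  · rw [not_le] at h1
    refine (abs_fiW0_le C n).trans ?_
    rw [if_pos h2, le_div_iff₀ hτ, sq]
    exact mul_le_mul_of_nonneg_left h1.le (Nat.cast_nonneg _)
  · simp [fiW0, ArithmeticFunction.moebius_eq_zero_of_not_squarefree h2]

/-! ### Linearity and the trivial bound for inner sums -/

/-- Weighted inner sums are additive in the weight. [folklore] -/
theorem fiWSum_add (S : Finset ℕ) (w₁ w₂ : ℕ → ℝ) (m : ℕ) :
    fiWSum S (fun n => w₁ n + w₂ n) m = fiWSum S w₁ m + fiWSum S w₂ m := by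
  simp only [fiWSum, add_mul, sum_add_distrib]

/-- Weighted inner sums are additive in the weight (finite sums). [folklore] -/
theorem fiWSum_sum {ι : Type*} (T : Finset ι) (S : Finset ℕ) (w : ι → ℕ → ℝ) (m : ℕ) :
    fiWSum S (fun n => ∑ i ∈ T, w i n) m = ∑ i ∈ T, fiWSum S (w i) m := by
  simp only [fiWSum, sum_mul]
  rw [sum_comm]

/-- Weighted inner sums are homogeneous in the weight. [folklore] -/
theorem fiWSum_mul_left (S : Finset ℕ) (c : ℝ) (w : ℕ → ℝ) (m : ℕ) :
    fiWSum S (fun n => c * w n) m = c * fiWSum S w m := by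
  simp only [fiWSum, mul_sum, mul_assoc]

/-- `|Σ_n w(n) a_{mn}| ≤ Σ_n |w(n)| a_{mn}`. [folklore] -/
theorem abs_fiWSum_le (S : Finset ℕ) (w : ℕ → ℝ) (m : ℕ) :
    |fiWSum S w m| ≤ ∑ n ∈ S, |w n| * (fiRepCount (m * n) : ℝ) := by
  unfold fiWSum
  refine (abs_sum_le_sum_abs _ _).trans (le_of_eq (sum_congr rfl fun n _ => ?_))
  rw [abs_mul, Nat.abs_cast]

/-- `|Σ_{n ∈ S} w a| ≤ Σ_{n ∈ S} g a` when `|w| ≤ g` on `S`. [folklore] -/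
theorem abs_fiWSum_le_of_le (S : Finset ℕ) {w g : ℕ → ℝ} (h : ∀ n ∈ S, |w n| ≤ g n) (m : ℕ) :
    |fiWSum S w m| ≤ ∑ n ∈ S, g n * (fiRepCount (m * n) : ℝ) :=
  (abs_fiWSum_le S w m).trans (sum_le_sum fun n hn =>
    mul_le_mul_of_nonneg_right (h n hn) (Nat.cast_nonneg _))

/-- **Exchange of summations, shell form**: if every pair `(m, n)` that is counted has `m ≥ 1` and
`y₁ < mn ≤ y₂`, then `Σ_m Σ_{n ∈ Sn, cond} g(n) a_{mn} ≤ Σ_{n ∈ Sn} g(n) (A_n(y₂) - A_n(y₁))` for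
`g ≥ 0`. [folklore] -/
theorem sum_sum_filter_le_sum_congrSum_sub (Sm Sn : Finset ℕ) (cond : ℕ → ℕ → Prop)
    [∀ m n, Decidable (cond m n)] {g : ℕ → ℝ} (hg : ∀ n ∈ Sn, 0 ≤ g n) (hSn : ∀ n ∈ Sn, 0 < n)
    {y₁ y₂ : ℝ} (hy₁ : 0 ≤ y₁) (hy : y₁ ≤ y₂)
    (h : ∀ m ∈ Sm, ∀ n ∈ Sn, cond m n → y₁ < (m * n : ℕ) ∧ ((m * n : ℕ) : ℝ) ≤ y₂) :
    ∑ m ∈ Sm, ∑ n ∈ Sn.filter (cond m), g n * (fiRepCount (m * n) : ℝ) ≤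
      ∑ n ∈ Sn, g n * (fiSieveSeq.congrSum n y₂ - fiSieveSeq.congrSum n y₁) := by
  calc ∑ m ∈ Sm, ∑ n ∈ Sn.filter (cond m), g n * (fiRepCount (m * n) : ℝ)
      = ∑ m ∈ Sm, ∑ n ∈ Sn, if cond m n then g n * (fiRepCount (m * n) : ℝ) else 0 := by
        refine sum_congr rfl fun m _ => ?_; rw [sum_filter]
    _ = ∑ n ∈ Sn, ∑ m ∈ Sm, if cond m n then g n * (fiRepCount (m * n) : ℝ) else 0 := sum_comm
    _ = ∑ n ∈ Sn, g n * ∑ m ∈ Sm.filter (fun m => cond m n), (fiRepCount (m * n) : ℝ) := by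
        refine sum_congr rfl fun n _ => ?_
        rw [sum_filter, mul_sum]
        refine sum_congr rfl fun m _ => ?_
        split_ifs <;> simp
    _ ≤ ∑ n ∈ Sn, g n * (fiSieveSeq.congrSum n y₂ - fiSieveSeq.congrSum n y₁) := by
        refine sum_le_sum fun n hn => mul_le_mul_of_nonneg_left ?_ (hg n hn)
        exact sum_fiRepCount_mul_le_congrSum_sub (hSn n hn) hy₁ hy _ fun m hm =>
          h m (mem_filter.mp hm).1 n hn (mem_filter.mp hm).2

/-- **Exchange of summations**: if every counted pair has `m ≥ 1` and `mn ≤ y`, then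
`Σ_m Σ_{n ∈ Sn, cond} g(n) a_{mn} ≤ Σ_{n ∈ Sn} g(n) A_n(y)` for `g ≥ 0`. [folklore] -/
theorem sum_sum_filter_le_sum_congrSum (Sm Sn : Finset ℕ) (cond : ℕ → ℕ → Prop)
    [∀ m n, Decidable (cond m n)] {g : ℕ → ℝ} (hg : ∀ n ∈ Sn, 0 ≤ g n) (hSn : ∀ n ∈ Sn, 0 < n)
    (hSm : ∀ m ∈ Sm, 1 ≤ m) {y : ℝ} (hy : 0 ≤ y)
    (h : ∀ m ∈ Sm, ∀ n ∈ Sn, cond m n → ((m * n : ℕ) : ℝ) ≤ y) :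
    ∑ m ∈ Sm, ∑ n ∈ Sn.filter (cond m), g n * (fiRepCount (m * n) : ℝ) ≤
      ∑ n ∈ Sn, g n * fiSieveSeq.congrSum n y := by
  have h' := sum_sum_filter_le_sum_congrSum_sub Sm Sn cond hg hSn le_rfl hy fun m hm n hn hc =>
    ⟨by
      have h1 : 1 ≤ m * n := Nat.one_le_iff_ne_zero.mpr
        (Nat.mul_ne_zero_iff.mpr ⟨by have := hSm m hm; omega, (hSn n hn).ne'⟩)
      exact_mod_cast h1, h m hm n hn hc⟩
  simpa [congrSum_zero_right] using h'


/-! ### Pointwise sizes: `A_n` against divisor sums -/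

/-- `n ∈ (⌊N⌋, ⌊2N⌋]` gives `n ≥ 1`. [folklore] -/
theorem pos_of_mem_Ioc_floor {N : ℝ} {n : ℕ} (hn : n ∈ Ioc ⌊N⌋₊ ⌊2 * N⌋₊) : 0 < n := by
  rw [mem_Ioc] at hn; omega

/-- `n ∈ (⌊N⌋, ⌊2N⌋]` gives `N < n`. [folklore] -/
theorem lt_of_mem_Ioc_floor {N : ℝ} {n : ℕ} (hn : n ∈ Ioc ⌊N⌋₊ ⌊2 * N⌋₊) : N < n := by
  rw [mem_Ioc] at hn; exact Nat.lt_of_floor_lt hn.1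

/-- `n ∈ (⌊N⌋, ⌊2N⌋]` gives `n ≤ 2N` (`N ≥ 0`). [folklore] -/
theorem le_of_mem_Ioc_floor {N : ℝ} (hN : 0 ≤ N) {n : ℕ} (hn : n ∈ Ioc ⌊N⌋₊ ⌊2 * N⌋₊) :
    (n : ℝ) ≤ 2 * N := by
  rw [mem_Ioc] at hn
  exact (Nat.le_floor_iff (by positivity)).mp hn.2

/-- `Σ_{n ∈ S, n squarefree} τ(n)^j A_n(y) ≤ (4κ+14) y^{3/4} Σ_{n ∈ S} τ(n)^{j+1}/n + 9 y^{1/4} Σ_{n ∈ S} τ(n)^{j+1}`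
for `y ≥ 1` (`congrSum_le_of_squarefree` and `A(y) ≤ (4κ+14) y^{3/4}`). [folklore] -/
theorem sum_pow_mul_congrSum_le (S : Finset ℕ) (hS : ∀ n ∈ S, 0 < n) (j : ℕ) {y : ℝ} (hy : 1 ≤ y) :
    ∑ n ∈ S.filter Squarefree, ((σ 0 n : ℕ) : ℝ) ^ j * fiSieveSeq.congrSum n y ≤
      (4 * friedlanderIwaniecKappa + 14) * y ^ (3 / 4 : ℝ) *
          ∑ n ∈ S, ((σ 0 n : ℕ) : ℝ) ^ (j + 1) / n +
        9 * y ^ (1 / 4 : ℝ) * ∑ n ∈ S, ((σ 0 n : ℕ) : ℝ) ^ (j + 1) := by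
  have hy0 : 0 ≤ y := zero_le_one.trans hy
  have hy4 : 1 ≤ y ^ (1 / 4 : ℝ) := Real.one_le_rpow hy (by norm_num)
  have hA := fiCount_le_rpow hy
  have hκ := friedlanderIwaniecKappa_pos
  calc ∑ n ∈ S.filter Squarefree, ((σ 0 n : ℕ) : ℝ) ^ j * fiSieveSeq.congrSum n y
      ≤ ∑ n ∈ S.filter Squarefree, ((σ 0 n : ℕ) : ℝ) ^ (j + 1) *
          ((4 * friedlanderIwaniecKappa + 14) * y ^ (3 / 4 : ℝ) / n + 9 * y ^ (1 / 4 : ℝ)) := by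
        refine sum_le_sum fun n hn => ?_
        obtain ⟨hnS, hsq⟩ := mem_filter.mp hn
        have hn0 := hS n hnS
        have hn0' : (0 : ℝ) < n := by exact_mod_cast hn0
        have h1 := congrSum_le_of_squarefree hn0 hsq hy0
        have h2 : fiCount y / n + 3 * (2 * y ^ (1 / 4 : ℝ) + 1) ≤
            (4 * friedlanderIwaniecKappa + 14) * y ^ (3 / 4 : ℝ) / n + 9 * y ^ (1 / 4 : ℝ) := by
          have : fiCount y / n ≤ (4 * friedlanderIwaniecKappa + 14) * y ^ (3 / 4 : ℝ) / n :=
            div_le_div_of_nonneg_right hA hn0'.le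
          linarith
        have hτ : (0 : ℝ) ≤ ((σ 0 n : ℕ) : ℝ) := Nat.cast_nonneg _
        calc ((σ 0 n : ℕ) : ℝ) ^ j * fiSieveSeq.congrSum n y
            ≤ ((σ 0 n : ℕ) : ℝ) ^ j * ((#n.divisors : ℝ) * (fiCount y / n + 3 * (2 * y ^ (1 / 4 : ℝ) + 1))) :=
              mul_le_mul_of_nonneg_left h1 (by positivity)
          _ ≤ ((σ 0 n : ℕ) : ℝ) ^ j * ((#n.divisors : ℝ) *
              ((4 * friedlanderIwaniecKappa + 14) * y ^ (3 / 4 : ℝ) / n + 9 * y ^ (1 / 4 : ℝ))) := by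
              gcongr
          _ = _ := by rw [ArithmeticFunction.sigma_zero_apply, pow_succ]; ring
    _ ≤ ∑ n ∈ S, ((σ 0 n : ℕ) : ℝ) ^ (j + 1) *
          ((4 * friedlanderIwaniecKappa + 14) * y ^ (3 / 4 : ℝ) / n + 9 * y ^ (1 / 4 : ℝ)) :=
        sum_le_sum_of_subset_of_nonneg (filter_subset _ _) fun n _ _ => by positivity
    _ = _ := by
        rw [mul_sum, mul_sum, ← sum_add_distrib]
        refine sum_congr rfl fun n _ => ?_
        ring

/-- The shell version: `Σ_{n squarefree} τ(n) (A_n(x) - A_n(x(1-θ))) ≤ (4κθx^{3/4} + 28√x) Σ τ²/n + 9 x^{1/4} Σ τ²`.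
[folklore] -/
theorem sum_mul_congrSum_sub_le (S : Finset ℕ) (hS : ∀ n ∈ S, 0 < n) {x θ : ℝ} (hθ0 : 0 ≤ θ)
    (hθ1 : θ ≤ 1) (hx1 : 1 ≤ x) (hx : 1 ≤ x * (1 - θ)) :
    ∑ n ∈ S.filter Squarefree, ((σ 0 n : ℕ) : ℝ) *
        (fiSieveSeq.congrSum n x - fiSieveSeq.congrSum n (x * (1 - θ))) ≤
      (4 * friedlanderIwaniecKappa * θ * x ^ (3 / 4 : ℝ) + 28 * Real.sqrt x) *
          ∑ n ∈ S, ((σ 0 n : ℕ) : ℝ) ^ 2 / n +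
        9 * x ^ (1 / 4 : ℝ) * ∑ n ∈ S, ((σ 0 n : ℕ) : ℝ) ^ 2 := by
  have hx0 : 0 ≤ x := by linarith
  have hxx : x * (1 - θ) ≤ x := by nlinarith
  have hx4 : 1 ≤ x ^ (1 / 4 : ℝ) := Real.one_le_rpow hx1 (by norm_num)
  have hA := fiCount_sub_thin_le hθ0 hθ1 hx
  have hκ := friedlanderIwaniecKappa_pos
  calc ∑ n ∈ S.filter Squarefree, ((σ 0 n : ℕ) : ℝ) *
        (fiSieveSeq.congrSum n x - fiSieveSeq.congrSum n (x * (1 - θ)))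
      ≤ ∑ n ∈ S.filter Squarefree, ((σ 0 n : ℕ) : ℝ) ^ 2 *
          ((4 * friedlanderIwaniecKappa * θ * x ^ (3 / 4 : ℝ) + 28 * Real.sqrt x) / n +
            9 * x ^ (1 / 4 : ℝ)) := by
        refine sum_le_sum fun n hn => ?_
        obtain ⟨hnS, hsq⟩ := mem_filter.mp hn
        have hn0 := hS n hnS
        have hn0' : (0 : ℝ) < n := by exact_mod_cast hn0
        have h1 := congrSum_sub_le_of_squarefree hn0 hsq (zero_le_one.trans hx) hxx
        have h2 : (fiCount x - fiCount (x * (1 - θ))) / n + 3 * (2 * x ^ (1 / 4 : ℝ) + 1) ≤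
            (4 * friedlanderIwaniecKappa * θ * x ^ (3 / 4 : ℝ) + 28 * Real.sqrt x) / n +
              9 * x ^ (1 / 4 : ℝ) := by
          have := div_le_div_of_nonneg_right hA hn0'.le
          linarith
        have hτ : (0 : ℝ) ≤ ((σ 0 n : ℕ) : ℝ) := Nat.cast_nonneg _
        calc ((σ 0 n : ℕ) : ℝ) * (fiSieveSeq.congrSum n x - fiSieveSeq.congrSum n (x * (1 - θ)))
            ≤ ((σ 0 n : ℕ) : ℝ) * ((#n.divisors : ℝ) *
                ((fiCount x - fiCount (x * (1 - θ))) / n + 3 * (2 * x ^ (1 / 4 : ℝ) + 1))) :=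
              mul_le_mul_of_nonneg_left h1 hτ
          _ ≤ ((σ 0 n : ℕ) : ℝ) * ((#n.divisors : ℝ) *
              ((4 * friedlanderIwaniecKappa * θ * x ^ (3 / 4 : ℝ) + 28 * Real.sqrt x) / n +
                9 * x ^ (1 / 4 : ℝ))) := by gcongr
          _ = _ := by rw [ArithmeticFunction.sigma_zero_apply, sq]; ring
    _ ≤ ∑ n ∈ S, ((σ 0 n : ℕ) : ℝ) ^ 2 *
          ((4 * friedlanderIwaniecKappa * θ * x ^ (3 / 4 : ℝ) + 28 * Real.sqrt x) / n +
            9 * x ^ (1 / 4 : ℝ)) :=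
        sum_le_sum_of_subset_of_nonneg (filter_subset _ _) fun n _ _ => by positivity
    _ = _ := by
        rw [mul_sum, mul_sum, ← sum_add_distrib]
        refine sum_congr rfl fun n _ => ?_
        ring

/-! ### (4.10): removing `τ(n) > τ` -/

/-- `Σ_m |Σ_{n ∈ F(m)} w_{>τ}(n) a_{mn}| ≤ τ⁻¹ Σ_{N < n ≤ 2N, squarefree} τ(n)² A_n(x)`.
[cite: FriedlanderIwaniecAnnals1998, (4.10)] -/
theorem sum_abs_fiWSum_fiWgt_le {x N P C τ : ℝ} (hx : 0 ≤ x) (hτ : 0 < τ) :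
    ∑ m ∈ Icc 1 ⌊x⌋₊, |fiWSum (fiRangeF x N P m) (fiWgt C τ) m| ≤
      τ⁻¹ * ∑ n ∈ (Ioc ⌊N⌋₊ ⌊2 * N⌋₊).filter Squarefree,
        ((σ 0 n : ℕ) : ℝ) ^ 2 * fiSieveSeq.congrSum n x := by
  set g : ℕ → ℝ := fun n => if Squarefree n then ((σ 0 n : ℕ) : ℝ) ^ 2 / τ else 0 with hg
  have hgn : ∀ n, 0 ≤ g n := fun n => by simp only [hg]; split_ifs <;> positivity
  calc ∑ m ∈ Icc 1 ⌊x⌋₊, |fiWSum (fiRangeF x N P m) (fiWgt C τ) m|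
      ≤ ∑ m ∈ Icc 1 ⌊x⌋₊, ∑ n ∈ fiRangeF x N P m, g n * (fiRepCount (m * n) : ℝ) :=
        sum_le_sum fun m _ => abs_fiWSum_le_of_le _ (fun n _ => abs_fiWgt_le hτ n) m
    _ ≤ ∑ n ∈ Ioc ⌊N⌋₊ ⌊2 * N⌋₊, g n * fiSieveSeq.congrSum n x := by
        unfold fiRangeF
        exact sum_sum_filter_le_sum_congrSum (Icc 1 ⌊x⌋₊) (Ioc ⌊N⌋₊ ⌊2 * N⌋₊)
          (fun m n => ((m * n : ℕ) : ℝ) ≤ x ∧ n.Coprime m ∧ ∀ p ∈ n.primeFactors, P ≤ (p : ℝ))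
          (fun n _ => hgn n) (fun n hn => pos_of_mem_Ioc_floor hn)
          (fun m hm => (mem_Icc.mp hm).1) hx (fun m _ n _ h => h.1)
    _ = τ⁻¹ * ∑ n ∈ (Ioc ⌊N⌋₊ ⌊2 * N⌋₊).filter Squarefree,
          ((σ 0 n : ℕ) : ℝ) ^ 2 * fiSieveSeq.congrSum n x := by
        rw [sum_filter, mul_sum]
        refine sum_congr rfl fun n _ => ?_
        simp only [hg]
        split_ifs <;> ring

/-! ### The residual of the partition (boundary terms `|n - N| < θN`, `|n - 2N| < θN`) -/

/-- The residual weight `r(n) = 1 - Σ_{k < K'} p_k(n)`. [folklore] -/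
def pouResidual (N θ : ℝ) (n : ℕ) : ℝ := 1 - ∑ k ∈ range (pouCount θ), pouPiece N θ k n

/-- `|r(n)| ≤ 1`. [folklore] -/
theorem abs_pouResidual_le {N θ : ℝ} (hN : 0 < N) (hθ : 0 < θ) (n : ℕ) : |pouResidual N θ n| ≤ 1 := by
  have h := sum_pouPiece_mem_Icc hN hθ (n : ℝ)
  rw [pouResidual, abs_le]
  constructor <;> linarith [h.1, h.2]

/-- `r(n) = 0` off the residual zones (`θ ≤ 1/2`). [folklore] -/
theorem pouResidual_eq_zero {N θ : ℝ} (hN : 0 < N) (hθ : 0 < θ) (hθ2 : θ ≤ 1 / 2) {n : ℕ}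
    (hn : ¬((n : ℝ) < N + θ * N ∨ 2 * N - θ * N < n)) : pouResidual N θ n = 0 := by
  rw [pouResidual, sub_eq_zero]
  by_contra h
  exact hn (residual_zone hN hθ hθ2 (Ne.symm h))

/-- The boundary terms: `Σ_m |Σ_{n ∈ F(m)} r(n) w_{≤τ}(n) a_{mn}| ≤ Σ_{n ∈ zone, squarefree} τ(n) A_n(x)`.
[cite: FriedlanderIwaniecAnnals1998, §4, display before (4.15)] -/
theorem sum_abs_fiWSum_residual_le {x N P C τ θ : ℝ} (hx : 0 ≤ x) (hN : 0 < N) (hθ : 0 < θ)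
    (hθ2 : θ ≤ 1 / 2) :
    ∑ m ∈ Icc 1 ⌊x⌋₊, |fiWSum (fiRangeF x N P m) (fun n => pouResidual N θ n * fiWle C τ n) m| ≤
      ∑ n ∈ (Ioc ⌊N⌋₊ ⌊2 * N⌋₊).filter
          (fun n : ℕ => Squarefree n ∧ ((n : ℝ) < N + θ * N ∨ 2 * N - θ * N < n)),
        ((σ 0 n : ℕ) : ℝ) * fiSieveSeq.congrSum n x := by
  set g : ℕ → ℝ := fun n => if Squarefree n ∧ ((n : ℝ) < N + θ * N ∨ 2 * N - θ * N < n) then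
    ((σ 0 n : ℕ) : ℝ) else 0 with hg
  have hgn : ∀ n, 0 ≤ g n := fun n => by simp only [hg]; split_ifs <;> positivity
  have hwg : ∀ n, |pouResidual N θ n * fiWle C τ n| ≤ g n := by
    intro n
    rw [abs_mul]
    by_cases hz : (n : ℝ) < N + θ * N ∨ 2 * N - θ * N < n
    · calc |pouResidual N θ n| * |fiWle C τ n| ≤ 1 * |fiWle C τ n| :=
            mul_le_mul_of_nonneg_right (abs_pouResidual_le hN hθ n) (abs_nonneg _)
        _ ≤ if Squarefree n then ((σ 0 n : ℕ) : ℝ) else 0 := by rw [one_mul]; exact abs_fiWle_le C τ n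
        _ = g n := by simp only [hg, hz, and_true]
    · rw [pouResidual_eq_zero hN hθ hθ2 hz, abs_zero, zero_mul]; exact hgn n
  calc ∑ m ∈ Icc 1 ⌊x⌋₊, |fiWSum (fiRangeF x N P m) (fun n => pouResidual N θ n * fiWle C τ n) m|
      ≤ ∑ m ∈ Icc 1 ⌊x⌋₊, ∑ n ∈ fiRangeF x N P m, g n * (fiRepCount (m * n) : ℝ) :=
        sum_le_sum fun m _ => abs_fiWSum_le_of_le _ (fun n _ => hwg n) m
    _ ≤ ∑ n ∈ Ioc ⌊N⌋₊ ⌊2 * N⌋₊, g n * fiSieveSeq.congrSum n x := by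
        unfold fiRangeF
        exact sum_sum_filter_le_sum_congrSum (Icc 1 ⌊x⌋₊) (Ioc ⌊N⌋₊ ⌊2 * N⌋₊)
          (fun m n => ((m * n : ℕ) : ℝ) ≤ x ∧ n.Coprime m ∧ ∀ p ∈ n.primeFactors, P ≤ (p : ℝ))
          (fun n _ => hgn n) (fun n hn => pos_of_mem_Ioc_floor hn)
          (fun m hm => (mem_Icc.mp hm).1) hx (fun m _ n _ h => h.1)
    _ = _ := by
        rw [sum_filter]
        refine sum_congr rfl fun n _ => ?_
        simp only [hg]
        split_ifs <;> ring

/-- The residual zone inside `(N, 2N]` has at most `2θN + 2` integers. [folklore] -/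
theorem card_zone_le {N θ : ℝ} (hN : 0 < N) (hθ : 0 < θ) (hθ2 : θ ≤ 1 / 2) :
    (#((Ioc ⌊N⌋₊ ⌊2 * N⌋₊).filter
        (fun n : ℕ => (n : ℝ) < N + θ * N ∨ 2 * N - θ * N < n)) : ℝ) ≤ 2 * θ * N + 2 := by
  have hsub : (Ioc ⌊N⌋₊ ⌊2 * N⌋₊).filter (fun n : ℕ => (n : ℝ) < N + θ * N ∨ 2 * N - θ * N < n) ⊆
      Ioc ⌊N⌋₊ ⌊N + θ * N⌋₊ ∪ Ioc ⌊2 * N - θ * N⌋₊ ⌊2 * N⌋₊ := by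
    intro n hn
    obtain ⟨hn1, hn2⟩ := mem_filter.mp hn
    rw [mem_Ioc] at hn1
    rcases hn2 with h | h
    · exact mem_union_left _ (mem_Ioc.mpr ⟨hn1.1, Nat.le_floor h.le⟩)
    · refine mem_union_right _ (mem_Ioc.mpr ⟨(Nat.floor_lt (by nlinarith)).mpr h, hn1.2⟩)
  have h1 : (#(Ioc ⌊N⌋₊ ⌊N + θ * N⌋₊) : ℝ) ≤ θ * N + 1 := by
    rw [Nat.card_Ioc]
    have hfl1 : ((⌊N + θ * N⌋₊ : ℕ) : ℝ) ≤ N + θ * N := Nat.floor_le (by positivity)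
    have hfl2 : N < (⌊N⌋₊ : ℕ) + 1 := Nat.lt_floor_add_one N
    rcases le_or_gt ⌊N⌋₊ ⌊N + θ * N⌋₊ with hle | hle
    · rw [Nat.cast_sub hle]; linarith
    · rw [Nat.sub_eq_zero_of_le hle.le]; simp; positivity
  have h2 : (#(Ioc ⌊2 * N - θ * N⌋₊ ⌊2 * N⌋₊) : ℝ) ≤ θ * N + 1 := by
    rw [Nat.card_Ioc]
    have hfl1 : ((⌊2 * N⌋₊ : ℕ) : ℝ) ≤ 2 * N := Nat.floor_le (by positivity)
    have hfl2 : 2 * N - θ * N < (⌊2 * N - θ * N⌋₊ : ℕ) + 1 := Nat.lt_floor_add_one _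
    rcases le_or_gt ⌊2 * N - θ * N⌋₊ ⌊2 * N⌋₊ with hle | hle
    · rw [Nat.cast_sub hle]; linarith
    · rw [Nat.sub_eq_zero_of_le hle.le]; simp; positivity
  calc _ ≤ (#(Ioc ⌊N⌋₊ ⌊N + θ * N⌋₊ ∪ Ioc ⌊2 * N - θ * N⌋₊ ⌊2 * N⌋₊) : ℝ) := by
        exact_mod_cast card_le_card hsub
    _ ≤ (#(Ioc ⌊N⌋₊ ⌊N + θ * N⌋₊) : ℝ) + #(Ioc ⌊2 * N - θ * N⌋₊ ⌊2 * N⌋₊) := by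
        exact_mod_cast card_union_le _ _
    _ ≤ (θ * N + 1) + (θ * N + 1) := add_le_add h1 h2
    _ = 2 * θ * N + 2 := by ring

/-- The boundary contribution in closed form:
`Σ_{zone, squarefree} τ(n) A_n(x) ≤ ((4κ+14) x^{3/4}/N + 9 x^{1/4}) √(2θN + 2) √(Σ_{n ≤ 2N} τ(n)⁴)`. [folklore] -/
theorem sum_zone_congrSum_le {x N θ : ℝ} (hx : 1 ≤ x) (hN : 0 < N) (hθ : 0 < θ) (hθ2 : θ ≤ 1 / 2) :
    ∑ n ∈ (Ioc ⌊N⌋₊ ⌊2 * N⌋₊).filter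
          (fun n : ℕ => Squarefree n ∧ ((n : ℝ) < N + θ * N ∨ 2 * N - θ * N < n)),
        ((σ 0 n : ℕ) : ℝ) * fiSieveSeq.congrSum n x ≤
      ((4 * friedlanderIwaniecKappa + 14) * x ^ (3 / 4 : ℝ) / N + 9 * x ^ (1 / 4 : ℝ)) *
        (Real.sqrt (2 * θ * N + 2) *
          Real.sqrt (∑ n ∈ Icc 1 ⌊2 * N⌋₊, ((σ 0 n : ℕ) : ℝ) ^ 4)) := by
  set Z := (Ioc ⌊N⌋₊ ⌊2 * N⌋₊).filter
    (fun n : ℕ => (n : ℝ) < N + θ * N ∨ 2 * N - θ * N < n) with hZ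
  have hZS : ∀ n ∈ Z, 0 < n := fun n hn => pos_of_mem_Ioc_floor (mem_filter.mp hn).1
  have hfilt : (Ioc ⌊N⌋₊ ⌊2 * N⌋₊).filter
      (fun n : ℕ => Squarefree n ∧ ((n : ℝ) < N + θ * N ∨ 2 * N - θ * N < n)) =
      Z.filter Squarefree := by
    ext n; simp only [hZ, mem_filter]; tauto
  rw [hfilt]
  have h1 := sum_pow_mul_congrSum_le Z hZS 1 hx
  simp only [pow_one] at h1
  have hκ := friedlanderIwaniecKappa_pos
  have hx0 : 0 ≤ x := zero_le_one.trans hx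
  -- `1/n ≤ 1/N` on `Z`
  have hinv : ∑ n ∈ Z, ((σ 0 n : ℕ) : ℝ) ^ 2 / n ≤ N⁻¹ * ∑ n ∈ Z, ((σ 0 n : ℕ) : ℝ) ^ 2 := by
    rw [mul_sum]
    refine sum_le_sum fun n hn => ?_
    have hNn : N < n := lt_of_mem_Ioc_floor (mem_filter.mp hn).1
    rw [div_eq_mul_inv, mul_comm]
    exact mul_le_mul_of_nonneg_right (inv_anti₀ hN hNn.le) (by positivity)
  have hZsub : Z ⊆ Icc 1 ⌊2 * N⌋₊ := by
    intro n hn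
    have h := (mem_filter.mp hn).1
    rw [mem_Ioc] at h
    exact mem_Icc.mpr ⟨by omega, h.2⟩
  have hcs := sum_sigma_zero_sq_le_sqrt_card hZsub
  have hcard := card_zone_le hN hθ hθ2
  have hsq : Real.sqrt #Z ≤ Real.sqrt (2 * θ * N + 2) := Real.sqrt_le_sqrt hcard
  set T := ∑ n ∈ Z, ((σ 0 n : ℕ) : ℝ) ^ 2 with hT
  have hT0 : 0 ≤ T := sum_nonneg fun _ _ => by positivity
  set R := Real.sqrt (∑ n ∈ Icc 1 ⌊2 * N⌋₊, ((σ 0 n : ℕ) : ℝ) ^ 4) with hR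
  have hR0 : 0 ≤ R := Real.sqrt_nonneg _
  have hTle : T ≤ Real.sqrt (2 * θ * N + 2) * R :=
    hcs.trans (mul_le_mul_of_nonneg_right hsq hR0)
  calc ∑ n ∈ Z.filter Squarefree, ((σ 0 n : ℕ) : ℝ) * fiSieveSeq.congrSum n x
      ≤ (4 * friedlanderIwaniecKappa + 14) * x ^ (3 / 4 : ℝ) * ∑ n ∈ Z, ((σ 0 n : ℕ) : ℝ) ^ 2 / n +
          9 * x ^ (1 / 4 : ℝ) * T := h1
    _ ≤ (4 * friedlanderIwaniecKappa + 14) * x ^ (3 / 4 : ℝ) * (N⁻¹ * T) + 9 * x ^ (1 / 4 : ℝ) * T := by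
        gcongr
    _ = ((4 * friedlanderIwaniecKappa + 14) * x ^ (3 / 4 : ℝ) / N + 9 * x ^ (1 / 4 : ℝ)) * T := by ring
    _ ≤ _ := mul_le_mul_of_nonneg_left hTle (by positivity)


/-! ### The smoothed pieces: splitting off the `x`-cutoff (boundary terms `|mn - x| < θx`) -/

/-- For the `k`-th piece and any `m ≥ 1`: either `m(u_k + θN) ≤ x`, and then the cutoff `mn ≤ x` is
automatic on the support of `p_k` (the inner sum of `B(x; N)` is the inner sum of `B*(M, N)`), or
every `n` in the support has `mn > x(1-θ)` (a boundary term). [cite: FriedlanderIwaniecAnnals1998, §4 between (4.14) and (4.15)] -/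
theorem abs_fiWSum_piece_le {x N P C τ θ : ℝ} (hN : 0 < N) (hθ : 0 < θ) (hθ1 : θ < 1) (k m : ℕ) :
    |fiWSum (fiRangeF x N P m) (fun n => pouPiece N θ k n * fiWle C τ n) m| ≤
      (if (m : ℝ) * (pouNode N θ k + θ * N) ≤ x then
          |fiWSum (fiRangeG N P m) (fun n => pouPiece N θ k n * fiWle C τ n) m| else 0) +
        ∑ n ∈ (fiRangeF x N P m).filter (fun n : ℕ => x * (1 - θ) < (m * n : ℕ)),
          pouPiece N θ k n * |fiWle C τ n| * (fiRepCount (m * n) : ℝ) := by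
  have hp0 := pouPiece_nonneg hN hθ k
  have hsum0 : 0 ≤ ∑ n ∈ (fiRangeF x N P m).filter (fun n : ℕ => x * (1 - θ) < (m * n : ℕ)),
      pouPiece N θ k n * |fiWle C τ n| * (fiRepCount (m * n) : ℝ) :=
    sum_nonneg fun n _ => by have := hp0 n; positivity
  by_cases hcase : (m : ℝ) * (pouNode N θ k + θ * N) ≤ x
  · rw [if_pos hcase]
    have heq : fiWSum (fiRangeF x N P m) (fun n => pouPiece N θ k n * fiWle C τ n) m =
        fiWSum (fiRangeG N P m) (fun n => pouPiece N θ k n * fiWle C τ n) m := by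
      unfold fiWSum
      rw [fiRangeF_eq_filter]
      apply sum_filter_of_ne
      intro n _ hne
      have hpn : pouPiece N θ k n ≠ 0 := by
        intro h0; apply hne; simp [h0]
      have hsupp := pouPiece_support hN hθ hpn
      have hm0 : (0 : ℝ) ≤ m := Nat.cast_nonneg m
      push_cast
      nlinarith [hsupp.2]
    rw [heq]
    linarith
  · rw [if_neg hcase, zero_add, not_le] at *
    refine (abs_fiWSum_le _ _ m).trans (le_of_eq ?_)
    symm
    rw [sum_filter_of_ne]
    · refine sum_congr rfl fun n _ => ?_
      rw [abs_mul, abs_of_nonneg (hp0 n)]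
    · intro n _ hne
      have hpn : pouPiece N θ k n ≠ 0 := by
        intro h0; apply hne; simp [h0]
      have hsupp := pouPiece_support hN hθ hpn
      have hm0 : (0 : ℝ) ≤ m := Nat.cast_nonneg m
      have hu := lt_pouNode hN hθ k
      -- `u_k ≥ (1 - θ)(u_k + θN)`
      have h1 : (1 - θ) * (pouNode N θ k + θ * N) ≤ pouNode N θ k := by nlinarith
      push_cast
      have h1θ : 0 < 1 - θ := by linarith
      have h2 : x * (1 - θ) < (m : ℝ) * (pouNode N θ k + θ * N) * (1 - θ) :=
        mul_lt_mul_of_pos_right hcase h1θ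
      nlinarith [hsupp.1]

/-- Summed over `m` and `k`, the boundary terms `x(1-θ) < mn ≤ x` contribute at most
`Σ_{squarefree} τ(n) (A_n(x) - A_n(x(1-θ)))` (`Σ_k p_k ≤ 1`). [folklore] -/
theorem sum_shell_le {x N P C τ θ : ℝ} (hN : 0 < N) (hθ : 0 < θ) (hθ1 : θ ≤ 1) (hx0 : 0 ≤ x) :
    ∑ m ∈ Icc 1 ⌊x⌋₊, ∑ n ∈ (fiRangeF x N P m).filter (fun n : ℕ => x * (1 - θ) < (m * n : ℕ)),
        (∑ k ∈ range (pouCount θ), pouPiece N θ k n) * |fiWle C τ n| * (fiRepCount (m * n) : ℝ) ≤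
      ∑ n ∈ (Ioc ⌊N⌋₊ ⌊2 * N⌋₊).filter Squarefree,
        ((σ 0 n : ℕ) : ℝ) * (fiSieveSeq.congrSum n x - fiSieveSeq.congrSum n (x * (1 - θ))) := by
  set g : ℕ → ℝ := fun n => if Squarefree n then ((σ 0 n : ℕ) : ℝ) else 0 with hg
  have hgn : ∀ n, 0 ≤ g n := fun n => by simp only [hg]; split_ifs <;> positivity
  have hxx : x * (1 - θ) ≤ x := by nlinarith
  have hx : 0 ≤ x * (1 - θ) := mul_nonneg hx0 (by linarith)
  calc _ ≤ ∑ m ∈ Icc 1 ⌊x⌋₊, ∑ n ∈ (fiRangeF x N P m).filter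
          (fun n : ℕ => x * (1 - θ) < (m * n : ℕ)), g n * (fiRepCount (m * n) : ℝ) := by
        refine sum_le_sum fun m _ => sum_le_sum fun n _ => ?_
        refine mul_le_mul_of_nonneg_right ?_ (Nat.cast_nonneg _)
        have h1 := (sum_pouPiece_mem_Icc hN hθ (n : ℝ)).2
        have h0 := (sum_pouPiece_mem_Icc hN hθ (n : ℝ)).1
        calc (∑ k ∈ range (pouCount θ), pouPiece N θ k n) * |fiWle C τ n| ≤ 1 * |fiWle C τ n| :=
              mul_le_mul_of_nonneg_right h1 (abs_nonneg _)
          _ ≤ g n := by rw [one_mul]; exact abs_fiWle_le C τ n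
    _ ≤ ∑ n ∈ Ioc ⌊N⌋₊ ⌊2 * N⌋₊, g n * (fiSieveSeq.congrSum n x - fiSieveSeq.congrSum n (x * (1 - θ))) := by
        simp only [fiRangeF, filter_filter]
        exact sum_sum_filter_le_sum_congrSum_sub (Icc 1 ⌊x⌋₊) (Ioc ⌊N⌋₊ ⌊2 * N⌋₊)
          (fun m n => (((m * n : ℕ) : ℝ) ≤ x ∧ n.Coprime m ∧ ∀ p ∈ n.primeFactors, P ≤ (p : ℝ)) ∧
            x * (1 - θ) < (m * n : ℕ))
          (fun n _ => hgn n) (fun n hn => pos_of_mem_Ioc_floor hn) hx hxx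
          (fun m _ n _ h => ⟨h.2, h.1.1⟩)
    _ = _ := by
        rw [sum_filter]
        refine sum_congr rfl fun n _ => ?_
        simp only [hg]
        split_ifs <;> ring

/-! ### The forms `B*(M, N)`: matching the inner sums, and the sign trick -/

/-- `β(n) = [(n, Π) = 1] p(n) w_{≤τ}(n)` ((4.13) against the weights of this file). [cite: FriedlanderIwaniecAnnals1998, (4.13)] -/
theorem fiBeta_eq_ite (p : ℝ → ℝ) (C P τ : ℝ) (n : ℕ) :
    fiBeta p C P τ n = if (∀ q ∈ n.primeFactors, P ≤ (q : ℝ)) then p n * fiWle C τ n else 0 := by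
  unfold fiBeta fiWle fiW0
  by_cases h2 : ∀ q ∈ n.primeFactors, P ≤ (q : ℝ)
  · by_cases h3 : ((σ 0 n : ℕ) : ℝ) ≤ τ
    · rw [if_pos ⟨h2, h3⟩, if_pos h2, if_pos h3]; ring
    · rw [if_neg (fun h => h3 h.2), if_pos h2, if_neg h3]; ring
  · rw [if_neg (fun h => h2 h.1), if_neg h2]

/-- **The inner sum of `B*(M, N)` is the inner sum of the `k`-th smoothed piece of `B(x; N)`**
(without the `x`-cutoff): the two index ranges differ only off the support of `p`.
[cite: FriedlanderIwaniecAnnals1998, (4.20)] -/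
theorem inner_eq_fiWSum {N P C τ θ N' : ℝ} {p : ℝ → ℝ}
    (hsupp : ∀ u, p u ≠ 0 → (N' < u ∧ u ≤ (1 + θ) * N') ∧ (N < u ∧ u ≤ 2 * N)) (m : ℕ) :
    ∑ n ∈ (Ioc ⌊N'⌋₊ ⌊(1 + θ) * N'⌋₊).filter (fun n : ℕ => n.Coprime m),
        fiBeta p C P τ n * (fiRepCount (m * n) : ℝ) =
      fiWSum (fiRangeG N P m) (fun n => p n * fiWle C τ n) m := by
  classical
  set h : ℕ → ℝ := fun n => (if (∀ q ∈ n.primeFactors, P ≤ (q : ℝ)) then p n * fiWle C τ n else 0) *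
    (fiRepCount (m * n) : ℝ) with hh
  -- both sides are sums of `h` over `cop`-filtered ranges
  have hL : ∑ n ∈ (Ioc ⌊N'⌋₊ ⌊(1 + θ) * N'⌋₊).filter (fun n : ℕ => n.Coprime m),
      fiBeta p C P τ n * (fiRepCount (m * n) : ℝ) =
      ∑ n ∈ (Ioc ⌊N'⌋₊ ⌊(1 + θ) * N'⌋₊).filter (fun n : ℕ => n.Coprime m), h n :=
    sum_congr rfl fun n _ => by rw [hh, fiBeta_eq_ite]
  have hR : fiWSum (fiRangeG N P m) (fun n => p n * fiWle C τ n) m =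
      ∑ n ∈ (Ioc ⌊N⌋₊ ⌊2 * N⌋₊).filter (fun n : ℕ => n.Coprime m), h n := by
    unfold fiWSum fiRangeG
    rw [← filter_filter, sum_filter]
    refine sum_congr rfl fun n _ => ?_
    simp only [hh]
    split_ifs <;> simp
  rw [hL, hR]
  -- `h n ≠ 0` forces `n` into both ranges
  have hvan : ∀ n : ℕ, h n ≠ 0 → n ∈ Ioc ⌊N'⌋₊ ⌊(1 + θ) * N'⌋₊ ∧ n ∈ Ioc ⌊N⌋₊ ⌊2 * N⌋₊ := by
    intro n hn
    have hpn : p n ≠ 0 := by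
      intro h0; apply hn; simp [hh, h0]
    obtain ⟨⟨h1, h2⟩, h3, h4⟩ := hsupp n hpn
    refine ⟨mem_Ioc.mpr ⟨Nat.floor_lt' ?_ |>.mpr ?_ , Nat.le_floor h2⟩,
      mem_Ioc.mpr ⟨Nat.floor_lt' ?_ |>.mpr ?_, Nat.le_floor h4⟩⟩
    all_goals first
      | exact h1
      | exact h3
      | (intro h0; subst h0; simp at h1 h3; linarith)
  have key : ∀ S₁ S₂ : Finset ℕ, (∀ n, h n ≠ 0 → n ∈ S₁ ∧ n ∈ S₂) →
      ∑ n ∈ S₁.filter (fun n : ℕ => n.Coprime m), h n =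
        ∑ n ∈ (S₁ ∩ S₂).filter (fun n : ℕ => n.Coprime m), h n := by
    intro S₁ S₂ hS
    symm
    apply sum_subset
    · exact filter_subset_filter _ inter_subset_left
    · intro n hn1 hn2
      by_contra hne
      apply hn2
      rw [mem_filter] at hn1 ⊢
      exact ⟨mem_inter.mpr (hS n hne), hn1.2⟩
  rw [key _ _ hvan, key _ _ (fun n hn => (hvan n hn).symm), inter_comm]

/-- The sign trick: `Σ_m sign(I_m) I_m = Σ_m |I_m|` with unimodular complex `α(m) = sign(I_m)`.
[folklore] -/
theorem sum_sign_mul_eq (T : Finset ℕ) (I : ℕ → ℝ) :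
    ∑ m ∈ T, (if 0 ≤ I m then (1 : ℂ) else -1) * (I m : ℂ) = ((∑ m ∈ T, |I m| : ℝ) : ℂ) := by
  push_cast
  refine sum_congr rfl fun m _ => ?_
  split_ifs with h
  · rw [abs_of_nonneg h, one_mul]
  · rw [abs_of_neg (not_le.mp h)]; push_cast; ring

/-- The signs are unimodular. [folklore] -/
theorem norm_sign_le (r : ℝ) : ‖(if 0 ≤ r then (1 : ℂ) else -1)‖ ≤ 1 := by
  split_ifs <;> simp

/-- (4.23) at fixed `x, P, N, C` — the shape of the hypothesis of
`FriedlanderIwaniec1998_prop41_of_bilinear423` (there with `A₂ = 2A + 8`, `θ = (log x)^{-A'}`,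
`τ = (log x)^t`, `ϑ = (log x)^{-A}`): for all `M` with `x(log x)^{-A₂} < MN < x`, all `N < N' < 2N`,
every `C²` function `p` vanishing off `(N', (1+θ)N']` with `|p| ≤ 1`, `|p'| ≤ (θN)⁻¹`,
`|p''| ≤ (θN)⁻²` ((4.12)–(4.14)) and all complex `|α(m)| ≤ 1` (4.18):
`‖B*(M, N)‖ ≤ K₀ ϑ θ (MN)^{3/4} (log MN)⁴`. A parametrised predicate (hypothesis shape), not a
claim. [cite: FriedlanderIwaniecAnnals1998, (4.23)] -/
def BilinBoundAt (x P N C A₂ θ τ ϑ K₀ : ℝ) : Prop :=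
  ∀ M : ℝ, x / Real.log x ^ A₂ < M * N → M * N < x →
  ∀ N' : ℝ, N < N' → N' < 2 * N →
  ∀ p : ℝ → ℝ, ContDiff ℝ 2 p →
    (∀ u, p u ≠ 0 → N' < u ∧ u ≤ (1 + θ) * N') →
    (∀ u, |p u| ≤ 1) →
    (∀ u, |deriv p u| ≤ (θ * N)⁻¹) →
    (∀ u, |deriv (deriv p) u| ≤ (θ * N)⁻¹ ^ 2) →
  ∀ α : ℕ → ℂ, (∀ m, ‖α m‖ ≤ 1) →
    ‖fiBilinearStar α p M N' θ C P τ‖ ≤ K₀ * ϑ * θ * (M * N) ^ (3 / 4 : ℝ) * Real.log (M * N) ^ 4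

/-- **One dyadic block of one smoothed piece is a form `B*(M, N)`**, hence bounded by (4.23):
`Σ_{M < m ≤ 2M} |Σ_n p_k(n) w_{≤τ}(n) a_{mn}| ≤ 8M_ψ · K₀ ϑ θ (MN)^{3/4} (log MN)^4` (`8M_ψ`
normalises the derivatives (4.14) of `p_k`). [cite: FriedlanderIwaniecAnnals1998, (4.17)-(4.23)] -/
theorem sum_abs_block_le {x P N C A₂ θ τ ϑ K₀ : ℝ} (hB : BilinBoundAt x P N C A₂ θ τ ϑ K₀)
    {Mψ : ℝ} (hMψ : 1 ≤ Mψ) (hM' : ∀ s, |deriv Real.smoothTransition s| ≤ Mψ)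
    (hM'' : ∀ s, |deriv (deriv Real.smoothTransition) s| ≤ Mψ)
    (hN : 0 < N) (hθ : 0 < θ) {k : ℕ} (hk : k < pouCount θ)
    {M : ℝ} (hM1 : x / Real.log x ^ A₂ < M * N) (hM2 : M * N < x) :
    ∑ m ∈ Ioc ⌊M⌋₊ ⌊2 * M⌋₊, |fiWSum (fiRangeG N P m) (fun n => pouPiece N θ k n * fiWle C τ n) m| ≤
      8 * Mψ * (K₀ * ϑ * θ * (M * N) ^ (3 / 4 : ℝ) * Real.log (M * N) ^ 4) := by
  set c : ℝ := 8 * Mψ with hc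
  have hc0 : 0 < c := by rw [hc]; linarith
  set pt : ℝ → ℝ := fun u => pouPiece N θ k u / c with hpt
  set I : ℕ → ℝ := fun m => fiWSum (fiRangeG N P m) (fun n => pouPiece N θ k n * fiWle C τ n) m
    with hI
  set α : ℕ → ℂ := fun m => if 0 ≤ I m / c then (1 : ℂ) else -1 with hα
  have hu1 := lt_pouNode hN hθ k
  have hu2 : pouNode N θ k < 2 * N := by
    have := pouNode_add_le_two_mul hN hθ hk; nlinarith
  have hθN : 0 < θ * N := mul_pos hθ hN
  -- the hypotheses of (4.23) for `pt`
  have hsuppk : ∀ u, pt u ≠ 0 → (pouNode N θ k < u ∧ u ≤ (1 + θ) * pouNode N θ k) ∧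
      (N < u ∧ u ≤ 2 * N) := by
    intro u hu
    have hpu : pouPiece N θ k u ≠ 0 := fun h0 => hu (by simp [hpt, h0])
    have hs := pouPiece_support hN hθ hpu
    have h3 := pouNode_add_le hN hθ k
    have h4 := pouNode_add_le_two_mul hN hθ hk
    exact ⟨⟨hs.1, by linarith⟩, by linarith, by linarith⟩
  have hcd : ContDiff ℝ 2 pt := (contDiff_pouPiece N θ k).div_const c
  have hb0 : ∀ u, |pt u| ≤ 1 := fun u => by
    simp only [hpt]
    rw [abs_div, abs_of_pos hc0, div_le_one hc0]
    exact (abs_pouPiece_le_one hN hθ k u).trans (by rw [hc]; linarith)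
  have hderiv : deriv pt = fun u => deriv (pouPiece N θ k) u / c := by
    funext u; simp only [hpt]; exact deriv_div_const _
  have hb1 : ∀ u, |deriv pt u| ≤ (θ * N)⁻¹ := fun u => by
    rw [hderiv]; simp only
    rw [abs_div, abs_of_pos hc0, div_le_iff₀ hc0]
    refine (abs_deriv_pouPiece_le hM' hN hθ k u).trans ?_
    rw [hc]
    have : 0 ≤ (θ * N)⁻¹ := by positivity
    nlinarith
  have hb2 : ∀ u, |deriv (deriv pt) u| ≤ (θ * N)⁻¹ ^ 2 := fun u => by
    rw [hderiv, deriv_div_const, abs_div, abs_of_pos hc0, div_le_iff₀ hc0]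
    refine (abs_deriv_deriv_pouPiece_le hM'' hN hθ k u).trans ?_
    rw [hc]
    have : 0 ≤ (θ * N)⁻¹ ^ 2 := by positivity
    nlinarith
  have hαn : ∀ m, ‖α m‖ ≤ 1 := fun m => norm_sign_le _
  have hbound := hB M hM1 hM2 (pouNode N θ k) hu1 hu2 pt hcd (fun u hu => (hsuppk u hu).1) hb0 hb1
    hb2 α hαn
  -- identify `B*(M, N)` with `Σ_m α(m) I(m)/c`
  have hstar : fiBilinearStar α pt M (pouNode N θ k) θ C P τ = ((∑ m ∈ Ioc ⌊M⌋₊ ⌊2 * M⌋₊, |I m / c| : ℝ) : ℂ) := by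
    rw [← sum_sign_mul_eq, fiBilinearStar]
    refine sum_congr rfl fun m _ => ?_
    rw [← mul_sum, ← Complex.ofReal_sum, inner_eq_fiWSum hsuppk m]
    congr 2
    simp only [hI, hpt]
    rw [div_eq_inv_mul, ← fiWSum_mul_left]
    congr 1; funext n; ring
  have hnorm : ‖fiBilinearStar α pt M (pouNode N θ k) θ C P τ‖ = (∑ m ∈ Ioc ⌊M⌋₊ ⌊2 * M⌋₊, |I m|) / c := by
    rw [hstar, Complex.norm_real, Real.norm_eq_abs, abs_of_nonneg (sum_nonneg fun _ _ => abs_nonneg _)]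
    rw [sum_div]
    exact sum_congr rfl fun m _ => by rw [abs_div, abs_of_pos hc0]
  rw [hnorm, div_le_iff₀ hc0] at hbound
  calc ∑ m ∈ Ioc ⌊M⌋₊ ⌊2 * M⌋₊, |I m| ≤ _ := hbound
    _ = _ := by ring

/-! ### Dyadic decomposition of the `m`-range and the geometric sum -/

/-- `Σ_{[1, b]} = Σ_{[1, a]} + Σ_{(a, b]}` for `a ≤ b`. [folklore] -/
theorem sum_Icc_one_eq_add (f : ℕ → ℝ) {a b : ℕ} (h : a ≤ b) :
    ∑ m ∈ Icc 1 b, f m = ∑ m ∈ Icc 1 a, f m + ∑ m ∈ Ioc a b, f m := by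
  rw [← sum_union]
  · congr 1
    ext m
    simp only [mem_union, mem_Icc, mem_Ioc]
    omega
  · rw [disjoint_left]
    intro m h1 h2
    rw [mem_Icc] at h1; rw [mem_Ioc] at h2
    omega

/-- `[1, ⌊y⌋] = [1, ⌊y/2^J⌋] ∪ ⋃_{j<J} (⌊y/2^{j+1}⌋, ⌊y/2^j⌋]`, as a sum identity. [folklore] -/
theorem sum_Icc_floor_eq_dyadic (f : ℕ → ℝ) {y : ℝ} (hy : 0 ≤ y) (J : ℕ) :
    ∑ m ∈ Icc 1 ⌊y⌋₊, f m = ∑ m ∈ Icc 1 ⌊y / 2 ^ J⌋₊, f m +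
      ∑ j ∈ range J, ∑ m ∈ Ioc ⌊y / 2 ^ (j + 1)⌋₊ ⌊y / 2 ^ j⌋₊, f m := by
  induction J with
  | zero => simp
  | succ J ih =>
    rw [ih, sum_range_succ, sum_Icc_one_eq_add f (a := ⌊y / 2 ^ (J + 1)⌋₊) (b := ⌊y / 2 ^ J⌋₊)]
    · ring
    · apply Nat.floor_le_floor
      rw [pow_succ]
      exact div_le_div_of_nonneg_left hy (by positivity) (by linarith [pow_pos (two_pos (α := ℝ)) J])

/-- `(2^{3/4})⁻¹ ≤ 3/4`. [folklore] -/
theorem inv_two_rpow_le : ((2 : ℝ) ^ (3 / 4 : ℝ))⁻¹ ≤ 3 / 4 := by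
  have h1 : Real.sqrt 2 ≤ (2 : ℝ) ^ (3 / 4 : ℝ) := by
    rw [Real.sqrt_eq_rpow]
    exact Real.rpow_le_rpow_of_exponent_le (by norm_num) (by norm_num)
  have h2 : (4 / 3 : ℝ) ≤ Real.sqrt 2 := by
    rw [show (4 / 3 : ℝ) = Real.sqrt ((4 / 3) ^ 2) by rw [Real.sqrt_sq]; norm_num]
    exact Real.sqrt_le_sqrt (by norm_num)
  rw [inv_le_comm₀ (by positivity) (by norm_num)]
  linarith

/-- The dyadic blocks add up geometrically: `Σ_{j<J} (x/2^{j+1})^{3/4} ≤ 3 x^{3/4}`. [folklore] -/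
theorem sum_range_dyadic_rpow_le {x : ℝ} (hx : 0 ≤ x) (J : ℕ) :
    ∑ j ∈ range J, (x / 2 ^ (j + 1)) ^ (3 / 4 : ℝ) ≤ 3 * x ^ (3 / 4 : ℝ) := by
  set r : ℝ := ((2 : ℝ) ^ (3 / 4 : ℝ))⁻¹ with hr
  have hr0 : 0 ≤ r := by positivity
  have hr1 : r ≤ 3 / 4 := inv_two_rpow_le
  have hterm : ∀ j : ℕ, (x / 2 ^ (j + 1)) ^ (3 / 4 : ℝ) = x ^ (3 / 4 : ℝ) * r ^ (j + 1) := by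
    intro j
    rw [Real.div_rpow hx (by positivity), hr, inv_pow, div_eq_mul_inv]
    congr 2
    rw [← Real.rpow_natCast ((2 : ℝ) ^ (3 / 4 : ℝ)), ← Real.rpow_mul (by norm_num),
      mul_comm, Real.rpow_mul (by norm_num), Real.rpow_natCast]
  simp_rw [hterm]
  rw [← mul_sum]
  have hgeom : ∑ j ∈ range J, r ^ (j + 1) ≤ 3 := by
    have h1 : ∑ j ∈ range J, r ^ (j + 1) = r * ∑ j ∈ range J, r ^ j := by
      rw [mul_sum]; exact sum_congr rfl fun j _ => by ring
    rw [h1]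
    have h2 : ∑ j ∈ range J, r ^ j ≤ 4 := by
      have := geom_sum_Ico_le_of_lt_one hr0 (by linarith) (m := 0) (n := J)
      rw [← Finset.range_eq_Ico, pow_zero] at this
      refine this.trans ?_
      rw [div_le_iff₀ (by linarith)]; linarith
    nlinarith [sum_nonneg (fun j (_ : j ∈ range J) => pow_nonneg hr0 j)]
  calc x ^ (3 / 4 : ℝ) * ∑ j ∈ range J, r ^ (j + 1) ≤ x ^ (3 / 4 : ℝ) * 3 :=
        mul_le_mul_of_nonneg_left hgeom (Real.rpow_nonneg hx _)
    _ = 3 * x ^ (3 / 4 : ℝ) := by ring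

/-! ### The terms with small `m` -/

/-- The small-`m` terms of all pieces together:
`Σ_{m ≤ m₀} Σ_{n ∈ G(m)} (Σ_k p_k(n)) |w_{≤τ}(n)| a_{mn} ≤ Σ_{squarefree} τ(n) A_n(y)` when `2 m₀ N ≤ y`.
[folklore] -/
theorem sum_small_le {N P C τ θ : ℝ} (hN : 0 < N) (hθ : 0 < θ) (m₀ : ℕ) {y : ℝ}
    (hy0 : 0 ≤ y) (hy : (m₀ : ℝ) * (2 * N) ≤ y) :
    ∑ m ∈ Icc 1 m₀, ∑ n ∈ fiRangeG N P m,
        (∑ k ∈ range (pouCount θ), pouPiece N θ k n) * |fiWle C τ n| * (fiRepCount (m * n) : ℝ) ≤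
      ∑ n ∈ (Ioc ⌊N⌋₊ ⌊2 * N⌋₊).filter Squarefree, ((σ 0 n : ℕ) : ℝ) * fiSieveSeq.congrSum n y := by
  set g : ℕ → ℝ := fun n => if Squarefree n then ((σ 0 n : ℕ) : ℝ) else 0 with hg
  have hgn : ∀ n, 0 ≤ g n := fun n => by simp only [hg]; split_ifs <;> positivity
  calc _ ≤ ∑ m ∈ Icc 1 m₀, ∑ n ∈ fiRangeG N P m, g n * (fiRepCount (m * n) : ℝ) := by
        refine sum_le_sum fun m _ => sum_le_sum fun n _ => ?_
        refine mul_le_mul_of_nonneg_right ?_ (Nat.cast_nonneg _)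
        have h1 := (sum_pouPiece_mem_Icc hN hθ (n : ℝ)).2
        calc (∑ k ∈ range (pouCount θ), pouPiece N θ k n) * |fiWle C τ n| ≤ 1 * |fiWle C τ n| :=
              mul_le_mul_of_nonneg_right h1 (abs_nonneg _)
          _ ≤ g n := by rw [one_mul]; exact abs_fiWle_le C τ n
    _ ≤ ∑ n ∈ Ioc ⌊N⌋₊ ⌊2 * N⌋₊, g n * fiSieveSeq.congrSum n y := by
        unfold fiRangeG
        refine sum_sum_filter_le_sum_congrSum (Icc 1 m₀) (Ioc ⌊N⌋₊ ⌊2 * N⌋₊)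
          (fun m n => n.Coprime m ∧ ∀ p ∈ n.primeFactors, P ≤ (p : ℝ))
          (fun n _ => hgn n) (fun n hn => pos_of_mem_Ioc_floor hn)
          (fun m hm => (mem_Icc.mp hm).1) hy0 (fun m hm n hn _ => ?_)
        have hm : (m : ℝ) ≤ m₀ := by exact_mod_cast (mem_Icc.mp hm).2
        have hn2 := le_of_mem_Ioc_floor hN.le hn
        push_cast
        calc (m : ℝ) * n ≤ m₀ * (2 * N) := by
              apply mul_le_mul hm hn2 (Nat.cast_nonneg _) (Nat.cast_nonneg _)
          _ ≤ y := hy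
    _ = _ := by
        rw [sum_filter]
        refine sum_congr rfl fun n _ => ?_
        simp only [hg]
        split_ifs <;> ring


/-! ### One smoothed piece: dyadic blocks plus small `m` -/

/-- For the `k`-th piece: the `m` with `m(u_k + θN) ≤ x` contribute at most
`24 M_ψ K₀ ϑ θ x^{3/4} (log x)⁴` (the dyadic blocks above `x(log x)^{-A₂}`, by (4.23)) plus the
small-`m` terms `m ≤ x N⁻¹ 2^{-J}`. [cite: FriedlanderIwaniecAnnals1998, (4.17)-(4.19)] -/
theorem sum_piece_main_le {x P N C A₂ θ τ ϑ K₀ : ℝ} (hB : BilinBoundAt x P N C A₂ θ τ ϑ K₀)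
    {Mψ : ℝ} (hMψ : 1 ≤ Mψ) (hM' : ∀ s, |deriv Real.smoothTransition s| ≤ Mψ)
    (hM'' : ∀ s, |deriv (deriv Real.smoothTransition) s| ≤ Mψ)
    (hN : 0 < N) (hθ : 0 < θ) (hϑ : 0 ≤ ϑ) (hK₀ : 0 ≤ K₀) {k : ℕ} (hk : k < pouCount θ)
    (hx : 0 < x) (hxA : 1 ≤ x / Real.log x ^ A₂) {J : ℕ} (hJ : x / Real.log x ^ A₂ < x / 2 ^ (J + 1)) :
    ∑ m ∈ Icc 1 ⌊x⌋₊, (if (m : ℝ) * (pouNode N θ k + θ * N) ≤ x then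
        |fiWSum (fiRangeG N P m) (fun n => pouPiece N θ k n * fiWle C τ n) m| else 0) ≤
      24 * Mψ * K₀ * ϑ * θ * x ^ (3 / 4 : ℝ) * Real.log x ^ 4 +
        ∑ m ∈ Icc 1 ⌊x / N / 2 ^ J⌋₊, ∑ n ∈ fiRangeG N P m,
          pouPiece N θ k n * |fiWle C τ n| * (fiRepCount (m * n) : ℝ) := by
  set I : ℕ → ℝ := fun m => fiWSum (fiRangeG N P m) (fun n => pouPiece N θ k n * fiWle C τ n) m
    with hI
  set U := pouNode N θ k + θ * N with hU
  have hu1 := lt_pouNode hN hθ k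
  have hU1 : N < U := by rw [hU]; nlinarith
  have hU2 : U ≤ 2 * N := pouNode_add_le_two_mul hN hθ hk
  have hU0 : 0 < U := hN.trans hU1
  set xk := x / U with hxk
  have hxk0 : 0 ≤ xk := by positivity
  have hxkN : xk * N ≤ x := by
    rw [hxk, div_mul_eq_mul_div, div_le_iff₀ hU0]; nlinarith
  have hxkN' : x / 2 ≤ xk * N := by
    rw [hxk, div_mul_eq_mul_div, le_div_iff₀ hU0]; nlinarith
  have hp0 := pouPiece_nonneg hN hθ k
  have hI0 : ∀ m, 0 ≤ |I m| := fun m => abs_nonneg _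
  -- Step 1: restrict to `m ≤ x_k`
  have h1 : ∑ m ∈ Icc 1 ⌊x⌋₊, (if (m : ℝ) * U ≤ x then |I m| else 0) ≤ ∑ m ∈ Icc 1 ⌊xk⌋₊, |I m| := by
    rw [← sum_filter]
    refine sum_le_sum_of_subset_of_nonneg (fun m hm => ?_) fun m _ _ => hI0 m
    obtain ⟨hm1, hm2⟩ := mem_filter.mp hm
    refine mem_Icc.mpr ⟨(mem_Icc.mp hm1).1, Nat.le_floor ?_⟩
    rw [hxk, le_div_iff₀ hU0]; exact hm2
  -- Step 2: dyadic decomposition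
  rw [sum_Icc_floor_eq_dyadic (fun m => |I m|) hxk0 J] at h1
  -- Step 3: the blocks
  have hlogx : 0 < Real.log x := by
    have : 1 < x := by
      by_contra hle; rw [not_lt] at hle
      have h2 : x / 2 ^ (J + 1) ≤ x / 2 := by
        apply div_le_div_of_nonneg_left hx.le (by norm_num)
        calc (2 : ℝ) = 2 ^ 1 := by norm_num
          _ ≤ 2 ^ (J + 1) := pow_le_pow_right₀ (by norm_num) (by omega)
      linarith
    exact Real.log_pos this
  have hblock : ∀ j ∈ range J, ∑ m ∈ Ioc ⌊xk / 2 ^ (j + 1)⌋₊ ⌊xk / 2 ^ j⌋₊, |I m| ≤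
      8 * Mψ * K₀ * ϑ * θ * Real.log x ^ 4 * (x / 2 ^ (j + 1)) ^ (3 / 4 : ℝ) := by
    intro j hj
    rw [mem_range] at hj
    set M := xk / 2 ^ (j + 1) with hM
    have h2M : xk / 2 ^ j = 2 * M := by
      rw [hM, pow_succ]; field_simp
    have hMN : M * N = xk * N / 2 ^ (j + 1) := by rw [hM]; ring
    have hMN1 : x / Real.log x ^ A₂ < M * N := by
      rw [hMN]
      calc x / Real.log x ^ A₂ < x / 2 ^ (J + 1) := hJ
        _ ≤ (x / 2) / 2 ^ (j + 1) := by
            rw [div_div, show (2 : ℝ) * 2 ^ (j + 1) = 2 ^ (j + 2) by ring]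
            exact div_le_div_of_nonneg_left hx.le (by positivity)
              (pow_le_pow_right₀ (by norm_num) (by omega))
        _ ≤ xk * N / 2 ^ (j + 1) := div_le_div_of_nonneg_right hxkN' (by positivity)
    have hMN2 : M * N < x := by
      rw [hMN]
      calc xk * N / 2 ^ (j + 1) ≤ xk * N / 2 := by
            apply div_le_div_of_nonneg_left (by positivity) (by norm_num)
            calc (2 : ℝ) = 2 ^ 1 := by norm_num
              _ ≤ 2 ^ (j + 1) := pow_le_pow_right₀ (by norm_num) (by omega)
        _ < x := by
            have : xk * N < x ∨ xk * N = x := lt_or_eq_of_le hxkN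
            have hpos : 0 < xk * N := by
              have := hMN1; rw [hMN] at this
              have h0 : 0 < x / Real.log x ^ A₂ := by linarith
              by_contra hle; rw [not_lt] at hle
              have : xk * N / 2 ^ (j + 1) ≤ 0 := div_nonpos_of_nonpos_of_nonneg hle (by positivity)
              linarith
            linarith
    have hb := sum_abs_block_le hB hMψ hM' hM'' hN hθ hk hMN1 hMN2
    rw [h2M]
    refine hb.trans ?_
    have hMN0 : 1 < M * N := lt_of_le_of_lt hxA hMN1
    have hlog0 : 0 ≤ Real.log (M * N) := Real.log_nonneg hMN0.le
    have hlog1 : Real.log (M * N) ≤ Real.log x := Real.log_le_log (by linarith) hMN2.le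
    have hpow : Real.log (M * N) ^ 4 ≤ Real.log x ^ 4 := pow_le_pow_left₀ hlog0 hlog1 4
    have hrp : (M * N) ^ (3 / 4 : ℝ) ≤ (x / 2 ^ (j + 1)) ^ (3 / 4 : ℝ) := by
      apply Real.rpow_le_rpow (by linarith) _ (by norm_num)
      rw [hMN]; exact div_le_div_of_nonneg_right hxkN (by positivity)
    have h8 : 0 ≤ 8 * Mψ * K₀ * ϑ * θ := by
      have : 0 ≤ Mψ := by linarith
      positivity
    calc 8 * Mψ * (K₀ * ϑ * θ * (M * N) ^ (3 / 4 : ℝ) * Real.log (M * N) ^ 4)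
        = 8 * Mψ * K₀ * ϑ * θ * ((M * N) ^ (3 / 4 : ℝ) * Real.log (M * N) ^ 4) := by ring
      _ ≤ 8 * Mψ * K₀ * ϑ * θ * ((x / 2 ^ (j + 1)) ^ (3 / 4 : ℝ) * Real.log x ^ 4) := by
          apply mul_le_mul_of_nonneg_left _ h8
          exact mul_le_mul hrp hpow (pow_nonneg hlog0 4) (Real.rpow_nonneg (by positivity) _)
      _ = _ := by ring
  have hblocks : ∑ j ∈ range J, ∑ m ∈ Ioc ⌊xk / 2 ^ (j + 1)⌋₊ ⌊xk / 2 ^ j⌋₊, |I m| ≤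
      24 * Mψ * K₀ * ϑ * θ * x ^ (3 / 4 : ℝ) * Real.log x ^ 4 := by
    refine (sum_le_sum hblock).trans ?_
    rw [← mul_sum]
    have h8 : 0 ≤ 8 * Mψ * K₀ * ϑ * θ * Real.log x ^ 4 := by
      have : 0 ≤ Mψ := by linarith
      positivity
    calc 8 * Mψ * K₀ * ϑ * θ * Real.log x ^ 4 * ∑ j ∈ range J, (x / 2 ^ (j + 1)) ^ (3 / 4 : ℝ)
        ≤ 8 * Mψ * K₀ * ϑ * θ * Real.log x ^ 4 * (3 * x ^ (3 / 4 : ℝ)) :=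
          mul_le_mul_of_nonneg_left (sum_range_dyadic_rpow_le hx.le J) h8
      _ = _ := by ring
  -- Step 4: the small `m`
  have hsmall : ∑ m ∈ Icc 1 ⌊xk / 2 ^ J⌋₊, |I m| ≤
      ∑ m ∈ Icc 1 ⌊x / N / 2 ^ J⌋₊, ∑ n ∈ fiRangeG N P m,
        pouPiece N θ k n * |fiWle C τ n| * (fiRepCount (m * n) : ℝ) := by
    have hsub : Icc 1 ⌊xk / 2 ^ J⌋₊ ⊆ Icc 1 ⌊x / N / 2 ^ J⌋₊ := by
      apply Icc_subset_Icc le_rfl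
      apply Nat.floor_le_floor
      apply div_le_div_of_nonneg_right _ (by positivity)
      rw [hxk]
      exact div_le_div_of_nonneg_left hx.le hN hU1.le
    calc ∑ m ∈ Icc 1 ⌊xk / 2 ^ J⌋₊, |I m|
        ≤ ∑ m ∈ Icc 1 ⌊xk / 2 ^ J⌋₊, ∑ n ∈ fiRangeG N P m,
            pouPiece N θ k n * |fiWle C τ n| * (fiRepCount (m * n) : ℝ) := by
          refine sum_le_sum fun m _ => (abs_fiWSum_le _ _ m).trans (le_of_eq ?_)
          exact sum_congr rfl fun n _ => by rw [abs_mul, abs_of_nonneg (hp0 n)]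
      _ ≤ _ := sum_le_sum_of_subset_of_nonneg hsub fun m _ _ =>
          sum_nonneg fun n _ => by have := hp0 n; positivity
  linarith

/-- **All smoothed pieces together**: with `K' θ ≤ 2`,
`Σ_k Σ_m [m(u_k+θN) ≤ x] |I_k(m)| ≤ 48 M_ψ K₀ ϑ x^{3/4}(log x)⁴ + Σ_{squarefree} τ(n) A_n(2x/2^J)`.
[cite: FriedlanderIwaniecAnnals1998, (4.17)] -/
theorem sum_pieces_main_le {x P N C A₂ θ τ ϑ K₀ : ℝ} (hB : BilinBoundAt x P N C A₂ θ τ ϑ K₀)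
    {Mψ : ℝ} (hMψ : 1 ≤ Mψ) (hM' : ∀ s, |deriv Real.smoothTransition s| ≤ Mψ)
    (hM'' : ∀ s, |deriv (deriv Real.smoothTransition) s| ≤ Mψ)
    (hN : 0 < N) (hθ : 0 < θ) (hϑ : 0 ≤ ϑ) (hK₀ : 0 ≤ K₀)
    (hx : 0 < x) (hxA : 1 ≤ x / Real.log x ^ A₂) {J : ℕ} (hJ : x / Real.log x ^ A₂ < x / 2 ^ (J + 1)) :
    ∑ k ∈ range (pouCount θ), ∑ m ∈ Icc 1 ⌊x⌋₊, (if (m : ℝ) * (pouNode N θ k + θ * N) ≤ x then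
        |fiWSum (fiRangeG N P m) (fun n => pouPiece N θ k n * fiWle C τ n) m| else 0) ≤
      48 * Mψ * K₀ * ϑ * x ^ (3 / 4 : ℝ) * Real.log x ^ 4 +
        ∑ n ∈ (Ioc ⌊N⌋₊ ⌊2 * N⌋₊).filter Squarefree,
          ((σ 0 n : ℕ) : ℝ) * fiSieveSeq.congrSum n (2 * x / 2 ^ J) := by
  have hpiece := fun k (hk : k ∈ range (pouCount θ)) =>
    sum_piece_main_le hB hMψ hM' hM'' hN hθ hϑ hK₀ (mem_range.mp hk) hx hxA hJ (P := P) (C := C) (τ := τ)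
  refine (sum_le_sum hpiece).trans ?_
  rw [sum_add_distrib, sum_const, card_range, nsmul_eq_mul]
  have hKθ : (pouCount θ : ℝ) * θ ≤ 2 := by
    have := pouCount_le hθ
    rwa [le_div_iff₀ hθ] at this
  have h1 : (pouCount θ : ℝ) * (24 * Mψ * K₀ * ϑ * θ * x ^ (3 / 4 : ℝ) * Real.log x ^ 4) ≤
      48 * Mψ * K₀ * ϑ * x ^ (3 / 4 : ℝ) * Real.log x ^ 4 := by
    have h0 : 0 ≤ 24 * Mψ * K₀ * ϑ * x ^ (3 / 4 : ℝ) * Real.log x ^ 4 := by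
      have : 0 ≤ Mψ := by linarith
      have : 0 ≤ Real.log x ^ 4 := by positivity
      positivity
    calc (pouCount θ : ℝ) * (24 * Mψ * K₀ * ϑ * θ * x ^ (3 / 4 : ℝ) * Real.log x ^ 4)
        = ((pouCount θ : ℝ) * θ) * (24 * Mψ * K₀ * ϑ * x ^ (3 / 4 : ℝ) * Real.log x ^ 4) := by ring
      _ ≤ 2 * (24 * Mψ * K₀ * ϑ * x ^ (3 / 4 : ℝ) * Real.log x ^ 4) :=
          mul_le_mul_of_nonneg_right hKθ h0
      _ = _ := by ring
  have h2 : ∑ k ∈ range (pouCount θ), ∑ m ∈ Icc 1 ⌊x / N / 2 ^ J⌋₊, ∑ n ∈ fiRangeG N P m,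
        pouPiece N θ k n * |fiWle C τ n| * (fiRepCount (m * n) : ℝ) ≤
      ∑ n ∈ (Ioc ⌊N⌋₊ ⌊2 * N⌋₊).filter Squarefree,
        ((σ 0 n : ℕ) : ℝ) * fiSieveSeq.congrSum n (2 * x / 2 ^ J) := by
    rw [sum_comm]
    have e : ∀ m : ℕ, ∑ k ∈ range (pouCount θ), ∑ n ∈ fiRangeG N P m,
        pouPiece N θ k n * |fiWle C τ n| * (fiRepCount (m * n) : ℝ) =
        ∑ n ∈ fiRangeG N P m, (∑ k ∈ range (pouCount θ), pouPiece N θ k n) * |fiWle C τ n| *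
          (fiRepCount (m * n) : ℝ) := by
      intro m
      rw [sum_comm]
      exact sum_congr rfl fun n _ => by rw [sum_mul, sum_mul]
    simp_rw [e]
    refine sum_small_le hN hθ _ (by positivity) ?_
    calc (⌊x / N / 2 ^ J⌋₊ : ℝ) * (2 * N) ≤ (x / N / 2 ^ J) * (2 * N) :=
          mul_le_mul_of_nonneg_right (Nat.floor_le (by positivity)) (by positivity)
      _ = 2 * x / 2 ^ J := by field_simp
  linarith


/-! ### The master inequality at fixed `x` -/

/-- **`B(x; N)` decomposed and estimated** (§4 of the source, all steps): for `θ ≤ 1/2`, `τ > 0`,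
a dyadic depth `J` with `x(log x)^{-A₂} < x 2^{-J-1}` and (4.23) in the shape `BilinBoundAt`,
`B(x; N) ≤ E₁ + E₂ + E₃ + (48 M_ψ K₀ ϑ x^{3/4} (log x)⁴ + E₄)` with
`E₁` = (4.10) (`τ(n) > τ` removed), `E₂` = the boundary `n` near `N, 2N`, `E₃` = the boundary
`|mn - x| < θx`, `E₄` = the small `m`, each an explicit divisor sum.
[cite: FriedlanderIwaniecAnnals1998, §4 (4.10)-(4.23)] -/
theorem fiBilinearPi_le_master {x P N C A₂ θ τ ϑ K₀ : ℝ} (hB : BilinBoundAt x P N C A₂ θ τ ϑ K₀)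
    {Mψ : ℝ} (hMψ : 1 ≤ Mψ) (hM' : ∀ s, |deriv Real.smoothTransition s| ≤ Mψ)
    (hM'' : ∀ s, |deriv (deriv Real.smoothTransition) s| ≤ Mψ)
    (hN : 0 < N) (hθ : 0 < θ) (hθ2 : θ ≤ 1 / 2) (hτ : 0 < τ) (hϑ : 0 ≤ ϑ) (hK₀ : 0 ≤ K₀)
    (hx : 2 ≤ x) (hxA : 1 ≤ x / Real.log x ^ A₂) {J : ℕ} (hJ : x / Real.log x ^ A₂ < x / 2 ^ (J + 1))
    (hy : 1 ≤ 2 * x / 2 ^ J) :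
    fiSieveSeq.fiBilinearPi x N C P ≤
      τ⁻¹ * ((4 * friedlanderIwaniecKappa + 14) * x ^ (3 / 4 : ℝ) *
            ∑ n ∈ Ioc ⌊N⌋₊ ⌊2 * N⌋₊, ((σ 0 n : ℕ) : ℝ) ^ 3 / n +
          9 * x ^ (1 / 4 : ℝ) * ∑ n ∈ Ioc ⌊N⌋₊ ⌊2 * N⌋₊, ((σ 0 n : ℕ) : ℝ) ^ 3) +
      ((4 * friedlanderIwaniecKappa + 14) * x ^ (3 / 4 : ℝ) / N + 9 * x ^ (1 / 4 : ℝ)) *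
        (Real.sqrt (2 * θ * N + 2) * Real.sqrt (∑ n ∈ Icc 1 ⌊2 * N⌋₊, ((σ 0 n : ℕ) : ℝ) ^ 4)) +
      ((4 * friedlanderIwaniecKappa * θ * x ^ (3 / 4 : ℝ) + 28 * Real.sqrt x) *
            ∑ n ∈ Ioc ⌊N⌋₊ ⌊2 * N⌋₊, ((σ 0 n : ℕ) : ℝ) ^ 2 / n +
          9 * x ^ (1 / 4 : ℝ) * ∑ n ∈ Ioc ⌊N⌋₊ ⌊2 * N⌋₊, ((σ 0 n : ℕ) : ℝ) ^ 2) +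
      (48 * Mψ * K₀ * ϑ * x ^ (3 / 4 : ℝ) * Real.log x ^ 4 +
        ((4 * friedlanderIwaniecKappa + 14) * (2 * x / 2 ^ J) ^ (3 / 4 : ℝ) *
            ∑ n ∈ Ioc ⌊N⌋₊ ⌊2 * N⌋₊, ((σ 0 n : ℕ) : ℝ) ^ 2 / n +
          9 * (2 * x / 2 ^ J) ^ (1 / 4 : ℝ) * ∑ n ∈ Ioc ⌊N⌋₊ ⌊2 * N⌋₊, ((σ 0 n : ℕ) : ℝ) ^ 2)) := by
  have hx0 : 0 < x := by linarith
  have hx1 : 1 ≤ x := by linarith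
  have hθ1 : θ < 1 := by linarith
  have hxθ : 1 ≤ x * (1 - θ) := by nlinarith
  have hSnpos : ∀ n ∈ Ioc ⌊N⌋₊ ⌊2 * N⌋₊, 0 < n := fun n hn => pos_of_mem_Ioc_floor hn
  -- the decomposition of the weights
  have hdec : ∀ m, fiWSum (fiRangeF x N P m) (fiW0 C) m = fiWSum (fiRangeF x N P m) (fiWgt C τ) m +
      (∑ k ∈ range (pouCount θ), fiWSum (fiRangeF x N P m) (fun n => pouPiece N θ k n * fiWle C τ n) m +
        fiWSum (fiRangeF x N P m) (fun n => pouResidual N θ n * fiWle C τ n) m) := by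
    intro m
    have e : fiW0 C = fun n => fiWgt C τ n +
        ((∑ k ∈ range (pouCount θ), pouPiece N θ k n * fiWle C τ n) +
          pouResidual N θ n * fiWle C τ n) := by
      funext n
      rw [pouResidual, fiW0_add C τ n, ← sum_mul]
      ring
    rw [e, fiWSum_add, fiWSum_add, fiWSum_sum]
  -- termwise triangle inequality
  have htri : ∀ m, |fiWSum (fiRangeF x N P m) (fiW0 C) m| ≤ |fiWSum (fiRangeF x N P m) (fiWgt C τ) m| +
      (∑ k ∈ range (pouCount θ), |fiWSum (fiRangeF x N P m) (fun n => pouPiece N θ k n * fiWle C τ n) m| +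
        |fiWSum (fiRangeF x N P m) (fun n => pouResidual N θ n * fiWle C τ n) m|) := by
    intro m
    rw [hdec m]
    have h1 := abs_add_le (fiWSum (fiRangeF x N P m) (fiWgt C τ) m)
      (∑ k ∈ range (pouCount θ), fiWSum (fiRangeF x N P m) (fun n => pouPiece N θ k n * fiWle C τ n) m +
        fiWSum (fiRangeF x N P m) (fun n => pouResidual N θ n * fiWle C τ n) m)
    have h2 := abs_add_le
      (∑ k ∈ range (pouCount θ), fiWSum (fiRangeF x N P m) (fun n => pouPiece N θ k n * fiWle C τ n) m)
      (fiWSum (fiRangeF x N P m) (fun n => pouResidual N θ n * fiWle C τ n) m)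
    have h3 := abs_sum_le_sum_abs
      (fun k => fiWSum (fiRangeF x N P m) (fun n => pouPiece N θ k n * fiWle C τ n) m)
      (range (pouCount θ))
    linarith
  have hA : ∑ m ∈ Icc 1 ⌊x⌋₊, |fiWSum (fiRangeF x N P m) (fiW0 C) m| ≤
      ∑ m ∈ Icc 1 ⌊x⌋₊, |fiWSum (fiRangeF x N P m) (fiWgt C τ) m| +
      (∑ m ∈ Icc 1 ⌊x⌋₊, ∑ k ∈ range (pouCount θ),
          |fiWSum (fiRangeF x N P m) (fun n => pouPiece N θ k n * fiWle C τ n) m| +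
        ∑ m ∈ Icc 1 ⌊x⌋₊, |fiWSum (fiRangeF x N P m) (fun n => pouResidual N θ n * fiWle C τ n) m|) := by
    calc _ ≤ ∑ m ∈ Icc 1 ⌊x⌋₊, (|fiWSum (fiRangeF x N P m) (fiWgt C τ) m| +
        (∑ k ∈ range (pouCount θ), |fiWSum (fiRangeF x N P m) (fun n => pouPiece N θ k n * fiWle C τ n) m| +
          |fiWSum (fiRangeF x N P m) (fun n => pouResidual N θ n * fiWle C τ n) m|)) :=
          sum_le_sum fun m _ => htri m
      _ = _ := by rw [sum_add_distrib, sum_add_distrib]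
  -- the pieces
  have hpw : ∀ m, ∑ k ∈ range (pouCount θ),
      |fiWSum (fiRangeF x N P m) (fun n => pouPiece N θ k n * fiWle C τ n) m| ≤
      ∑ k ∈ range (pouCount θ), ((if (m : ℝ) * (pouNode N θ k + θ * N) ≤ x then
          |fiWSum (fiRangeG N P m) (fun n => pouPiece N θ k n * fiWle C τ n) m| else 0) +
        ∑ n ∈ (fiRangeF x N P m).filter (fun n : ℕ => x * (1 - θ) < (m * n : ℕ)),
          pouPiece N θ k n * |fiWle C τ n| * (fiRepCount (m * n) : ℝ)) :=
    fun m => sum_le_sum fun k _ => abs_fiWSum_piece_le hN hθ hθ1 k m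
  have hB' : ∑ m ∈ Icc 1 ⌊x⌋₊, ∑ k ∈ range (pouCount θ),
      |fiWSum (fiRangeF x N P m) (fun n => pouPiece N θ k n * fiWle C τ n) m| ≤
      ∑ k ∈ range (pouCount θ), ∑ m ∈ Icc 1 ⌊x⌋₊,
          (if (m : ℝ) * (pouNode N θ k + θ * N) ≤ x then
            |fiWSum (fiRangeG N P m) (fun n => pouPiece N θ k n * fiWle C τ n) m| else 0) +
        ∑ m ∈ Icc 1 ⌊x⌋₊, ∑ n ∈ (fiRangeF x N P m).filter (fun n : ℕ => x * (1 - θ) < (m * n : ℕ)),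
          (∑ k ∈ range (pouCount θ), pouPiece N θ k n) * |fiWle C τ n| * (fiRepCount (m * n) : ℝ) := by
    calc _ ≤ ∑ m ∈ Icc 1 ⌊x⌋₊, ∑ k ∈ range (pouCount θ),
          ((if (m : ℝ) * (pouNode N θ k + θ * N) ≤ x then
            |fiWSum (fiRangeG N P m) (fun n => pouPiece N θ k n * fiWle C τ n) m| else 0) +
          ∑ n ∈ (fiRangeF x N P m).filter (fun n : ℕ => x * (1 - θ) < (m * n : ℕ)),
            pouPiece N θ k n * |fiWle C τ n| * (fiRepCount (m * n) : ℝ)) :=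
          sum_le_sum fun m _ => hpw m
      _ = (∑ m ∈ Icc 1 ⌊x⌋₊, ∑ k ∈ range (pouCount θ),
            (if (m : ℝ) * (pouNode N θ k + θ * N) ≤ x then
              |fiWSum (fiRangeG N P m) (fun n => pouPiece N θ k n * fiWle C τ n) m| else 0)) +
          ∑ m ∈ Icc 1 ⌊x⌋₊, ∑ k ∈ range (pouCount θ),
            ∑ n ∈ (fiRangeF x N P m).filter (fun n : ℕ => x * (1 - θ) < (m * n : ℕ)),
              pouPiece N θ k n * |fiWle C τ n| * (fiRepCount (m * n) : ℝ) := by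
          simp only [sum_add_distrib]
      _ = _ := by
          congr 1
          · exact sum_comm
          · refine sum_congr rfl fun m _ => ?_
            rw [sum_comm]
            refine sum_congr rfl fun n _ => ?_
            rw [sum_mul, sum_mul]
  -- E₁, E₂, main, E₃, E₄
  have hE1 := sum_abs_fiWSum_fiWgt_le (N := N) (P := P) (C := C) hx0.le hτ
  have hE1' := sum_pow_mul_congrSum_le (Ioc ⌊N⌋₊ ⌊2 * N⌋₊) hSnpos 2 hx1
  have hpos1 : 0 ≤ τ⁻¹ := by positivity
  have hE1'' := mul_le_mul_of_nonneg_left hE1' hpos1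
  have hE2 := sum_abs_fiWSum_residual_le (P := P) (C := C) (τ := τ) hx0.le hN hθ hθ2
  have hE2' := sum_zone_congrSum_le hx1 hN hθ hθ2
  have hmain := sum_pieces_main_le hB hMψ hM' hM'' hN hθ hϑ hK₀ hx0 hxA hJ (τ := τ)
  have hE4' := sum_pow_mul_congrSum_le (Ioc ⌊N⌋₊ ⌊2 * N⌋₊) hSnpos 1 hy
  have hE3 := sum_shell_le (P := P) (C := C) (τ := τ) hN hθ hθ1.le hx0.le
  have hE3' := sum_mul_congrSum_sub_le (Ioc ⌊N⌋₊ ⌊2 * N⌋₊) hSnpos hθ.le hθ1.le hx1 hxθ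
  simp only [pow_one, Nat.reduceAdd] at hE1'' hE4'
  -- assemble
  rw [fiBilinearPi_eq]
  linarith [hA, hB', hE1, hE1'', hE2, hE2', hmain, hE4', hE3, hE3']


/-! ### Elementary asymptotics: powers of `log x` -/

/-- `K (log x)^{e₁} ≤ (log x)^{e₂}` eventually, for `e₁ < e₂`. [folklore] -/
theorem eventually_mul_log_rpow_le {e₁ e₂ : ℝ} (h : e₁ < e₂) (K : ℝ) :
    ∀ᶠ x : ℝ in atTop, K * Real.log x ^ e₁ ≤ Real.log x ^ e₂ := by
  have ht : Tendsto (fun x : ℝ => Real.log x ^ (e₂ - e₁)) atTop atTop :=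
    (tendsto_rpow_atTop (by linarith)).comp Real.tendsto_log_atTop
  filter_upwards [ht.eventually_ge_atTop K, Real.tendsto_log_atTop.eventually_gt_atTop 0] with x hK hlog
  calc K * Real.log x ^ e₁ ≤ Real.log x ^ (e₂ - e₁) * Real.log x ^ e₁ :=
        mul_le_mul_of_nonneg_right hK (Real.rpow_nonneg hlog.le _)
    _ = Real.log x ^ e₂ := by rw [← Real.rpow_add hlog]; ring_nf

/-- `K (log x)^e ≤ x^s` eventually, for `s > 0`. [folklore] -/
theorem eventually_mul_log_rpow_le_rpow (e : ℝ) {s : ℝ} (hs : 0 < s) (K : ℝ) :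
    ∀ᶠ x : ℝ in atTop, K * Real.log x ^ e ≤ x ^ s := by
  have ho := isLittleO_log_rpow_rpow_atTop e hs
  have hK : 0 < |K| + 1 := by positivity
  filter_upwards [ho.def (inv_pos.mpr hK), eventually_ge_atTop (0 : ℝ)] with x hx hx0
  rw [Real.norm_eq_abs, Real.norm_eq_abs, abs_of_nonneg (Real.rpow_nonneg hx0 _)] at hx
  have h1 : K * Real.log x ^ e ≤ |K| * |Real.log x ^ e| := by
    rw [← abs_mul]; exact le_abs_self _
  refine h1.trans ((mul_le_mul_of_nonneg_left hx (abs_nonneg K)).trans ?_)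
  rw [← mul_assoc]
  refine mul_le_of_le_one_left (Real.rpow_nonneg hx0 _) ?_
  rw [mul_inv_le_iff₀ hK]; linarith

/-- The comparison shape used for every error term: `K x^{3/4} (log x)^e ≤ x^{3/4} (log x)^{4-A}`
eventually, for `e < 4 - A`. [folklore] -/
theorem eventually_le_target {e A : ℝ} (h : e < 4 - A) (K : ℝ) :
    ∀ᶠ x : ℝ in atTop, K * x ^ (3 / 4 : ℝ) * Real.log x ^ e ≤ x ^ (3 / 4 : ℝ) * Real.log x ^ (4 - A) := by
  filter_upwards [eventually_mul_log_rpow_le h K, eventually_ge_atTop (0 : ℝ)] with x hx hx0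
  calc K * x ^ (3 / 4 : ℝ) * Real.log x ^ e = x ^ (3 / 4 : ℝ) * (K * Real.log x ^ e) := by ring
    _ ≤ x ^ (3 / 4 : ℝ) * Real.log x ^ (4 - A) := mul_le_mul_of_nonneg_left hx (Real.rpow_nonneg hx0 _)

/-- The `√x (log x)⁸` term: `K √x (log x)⁸ ≤ x^{3/4} (log x)^{4-A}` eventually. [folklore] -/
theorem eventually_sqrt_le_target (A K : ℝ) :
    ∀ᶠ x : ℝ in atTop, K * Real.sqrt x * Real.log x ^ 8 ≤ x ^ (3 / 4 : ℝ) * Real.log x ^ (4 - A) := by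
  filter_upwards [eventually_mul_log_rpow_le_rpow (4 + A) (by norm_num : (0 : ℝ) < 1 / 4) K,
    eventually_gt_atTop (1 : ℝ)] with x hx hx1
  have hx0 : 0 < x := by linarith
  have hlog : 0 < Real.log x := Real.log_pos hx1
  have e8 : Real.log x ^ 8 = Real.log x ^ (4 + A) * Real.log x ^ (4 - A) := by
    rw [← Real.rpow_add hlog]; norm_num
  have e34 : x ^ (3 / 4 : ℝ) = x ^ (1 / 4 : ℝ) * Real.sqrt x := by
    rw [Real.sqrt_eq_rpow, ← Real.rpow_add hx0]; norm_num
  rw [e8, e34]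
  calc K * Real.sqrt x * (Real.log x ^ (4 + A) * Real.log x ^ (4 - A))
      = (K * Real.log x ^ (4 + A)) * (Real.sqrt x * Real.log x ^ (4 - A)) := by ring
    _ ≤ x ^ (1 / 4 : ℝ) * (Real.sqrt x * Real.log x ^ (4 - A)) :=
        mul_le_mul_of_nonneg_right hx (by positivity)
    _ = _ := by ring

/-! ### The divisor sums over `(N, 2N]` -/

/-- `(⌊N⌋, ⌊2N⌋] ⊆ [1, ⌊2N⌋]`. [folklore] -/
theorem Ioc_floor_subset_Icc (N : ℝ) : Ioc ⌊N⌋₊ ⌊2 * N⌋₊ ⊆ Icc 1 ⌊2 * N⌋₊ := by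
  intro n hn; rw [mem_Ioc] at hn; exact mem_Icc.mpr ⟨by omega, hn.2⟩

/-- `Σ_{N < n ≤ 2N} τ(n)^r / n ≤ C_r (log x)^{2^{r+1}}` for `1 ≤ N`, `2N ≤ x`. [folklore] -/
theorem sum_Ioc_sigma_pow_div_le {r : ℕ} {Cr : ℝ}
    (hCr : ∀ y : ℝ, 2 ≤ y → ∑ n ∈ Icc 1 ⌊y⌋₊, ((σ 0 n : ℕ) : ℝ) ^ r / n ≤ Cr * Real.log y ^ (2 ^ (r + 1)))
    {N x : ℝ} (hN : 1 ≤ N) (hNx : 2 * N ≤ x) (hCr0 : 0 ≤ Cr) :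
    ∑ n ∈ Ioc ⌊N⌋₊ ⌊2 * N⌋₊, ((σ 0 n : ℕ) : ℝ) ^ r / n ≤ Cr * Real.log x ^ (2 ^ (r + 1)) := by
  have h2 : (2 : ℝ) ≤ 2 * N := by linarith
  calc ∑ n ∈ Ioc ⌊N⌋₊ ⌊2 * N⌋₊, ((σ 0 n : ℕ) : ℝ) ^ r / n
      ≤ ∑ n ∈ Icc 1 ⌊2 * N⌋₊, ((σ 0 n : ℕ) : ℝ) ^ r / n :=
        sum_le_sum_of_subset_of_nonneg (Ioc_floor_subset_Icc N) fun _ _ _ => by positivity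
    _ ≤ Cr * Real.log (2 * N) ^ (2 ^ (r + 1)) := hCr _ h2
    _ ≤ Cr * Real.log x ^ (2 ^ (r + 1)) := by
        apply mul_le_mul_of_nonneg_left _ hCr0
        exact pow_le_pow_left₀ (Real.log_nonneg (by linarith)) (Real.log_le_log (by linarith) hNx) _

/-- `Σ_{N < n ≤ 2N} τ(n)^r ≤ 2 C_r' N (log x)^{2^{r+1}}` for `1 ≤ N`, `2N ≤ x`. [folklore] -/
theorem sum_Ioc_sigma_pow_le {r : ℕ} {Cr : ℝ}
    (hCr : ∀ y : ℝ, 2 ≤ y → ∑ n ∈ Icc 1 ⌊y⌋₊, ((σ 0 n : ℕ) : ℝ) ^ r ≤ Cr * y * Real.log y ^ (2 ^ (r + 1)))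
    {N x : ℝ} (hN : 1 ≤ N) (hNx : 2 * N ≤ x) (hCr0 : 0 ≤ Cr) :
    ∑ n ∈ Ioc ⌊N⌋₊ ⌊2 * N⌋₊, ((σ 0 n : ℕ) : ℝ) ^ r ≤ 2 * Cr * N * Real.log x ^ (2 ^ (r + 1)) := by
  have h2 : (2 : ℝ) ≤ 2 * N := by linarith
  calc ∑ n ∈ Ioc ⌊N⌋₊ ⌊2 * N⌋₊, ((σ 0 n : ℕ) : ℝ) ^ r
      ≤ ∑ n ∈ Icc 1 ⌊2 * N⌋₊, ((σ 0 n : ℕ) : ℝ) ^ r :=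
        sum_le_sum_of_subset_of_nonneg (Ioc_floor_subset_Icc N) fun _ _ _ => by positivity
    _ ≤ Cr * (2 * N) * Real.log (2 * N) ^ (2 ^ (r + 1)) := hCr _ h2
    _ ≤ Cr * (2 * N) * Real.log x ^ (2 ^ (r + 1)) := by
        apply mul_le_mul_of_nonneg_left _ (by positivity)
        exact pow_le_pow_left₀ (Real.log_nonneg (by linarith)) (Real.log_le_log (by linarith) hNx) _
    _ = _ := by ring

/-- `Σ_{n ≤ 2N} τ(n)^r ≤ 2 C_r' N (log x)^{2^{r+1}}`. [folklore] -/
theorem sum_Icc_sigma_pow_le {r : ℕ} {Cr : ℝ}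
    (hCr : ∀ y : ℝ, 2 ≤ y → ∑ n ∈ Icc 1 ⌊y⌋₊, ((σ 0 n : ℕ) : ℝ) ^ r ≤ Cr * y * Real.log y ^ (2 ^ (r + 1)))
    {N x : ℝ} (hN : 1 ≤ N) (hNx : 2 * N ≤ x) (hCr0 : 0 ≤ Cr) :
    ∑ n ∈ Icc 1 ⌊2 * N⌋₊, ((σ 0 n : ℕ) : ℝ) ^ r ≤ 2 * Cr * N * Real.log x ^ (2 ^ (r + 1)) := by
  have h2 : (2 : ℝ) ≤ 2 * N := by linarith
  calc ∑ n ∈ Icc 1 ⌊2 * N⌋₊, ((σ 0 n : ℕ) : ℝ) ^ r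
      ≤ Cr * (2 * N) * Real.log (2 * N) ^ (2 ^ (r + 1)) := hCr _ h2
    _ ≤ Cr * (2 * N) * Real.log x ^ (2 ^ (r + 1)) := by
        apply mul_le_mul_of_nonneg_left _ (by positivity)
        exact pow_le_pow_left₀ (Real.log_nonneg (by linarith)) (Real.log_le_log (by linarith) hNx) _
    _ = _ := by ring


/-! ### The four error terms against `x^{3/4} (log x)^{4-A}` (pure real arithmetic) -/

/-- `E₁` (4.10): `τ⁻¹ (κ₁ x^{3/4} S₃ + 9 x^{1/4} S₃') ≤ T`. [folklore] -/
theorem err1_le {x t κ₁ C₃ C₃' S₃ S₃' N T : ℝ} (hlog : 0 < Real.log x) (hx34 : 0 ≤ x ^ (3 / 4 : ℝ))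
    (hx4 : 0 ≤ x ^ (1 / 4 : ℝ)) (hκ₁ : 0 ≤ κ₁) (hC₃' : 0 ≤ C₃')
    (hS3 : S₃ ≤ C₃ * Real.log x ^ 16) (hS3' : S₃' ≤ 2 * C₃' * N * Real.log x ^ 16)
    (hx14N : x ^ (1 / 4 : ℝ) * N ≤ x ^ (3 / 4 : ℝ))
    (hxE1 : (κ₁ * C₃ + 18 * C₃') * x ^ (3 / 4 : ℝ) * Real.log x ^ (16 - t) ≤ T) :
    (Real.log x ^ t)⁻¹ * (κ₁ * x ^ (3 / 4 : ℝ) * S₃ + 9 * x ^ (1 / 4 : ℝ) * S₃') ≤ T := by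
  have hL16 : Real.log x ^ 16 = Real.log x ^ (16 : ℝ) := (Real.rpow_natCast _ 16).symm.trans (by norm_num)
  have h1 : κ₁ * x ^ (3 / 4 : ℝ) * S₃ + 9 * x ^ (1 / 4 : ℝ) * S₃' ≤
      (κ₁ * C₃ + 18 * C₃') * x ^ (3 / 4 : ℝ) * Real.log x ^ 16 := by
    have h2 : x ^ (1 / 4 : ℝ) * S₃' ≤ 2 * C₃' * x ^ (3 / 4 : ℝ) * Real.log x ^ 16 := by
      calc x ^ (1 / 4 : ℝ) * S₃' ≤ x ^ (1 / 4 : ℝ) * (2 * C₃' * N * Real.log x ^ 16) :=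
            mul_le_mul_of_nonneg_left hS3' hx4
        _ = 2 * C₃' * (x ^ (1 / 4 : ℝ) * N) * Real.log x ^ 16 := by ring
        _ ≤ 2 * C₃' * x ^ (3 / 4 : ℝ) * Real.log x ^ 16 := by gcongr
    have h3 : x ^ (3 / 4 : ℝ) * S₃ ≤ x ^ (3 / 4 : ℝ) * (C₃ * Real.log x ^ 16) :=
      mul_le_mul_of_nonneg_left hS3 hx34
    nlinarith
  have hτinv : (Real.log x ^ t)⁻¹ * Real.log x ^ 16 = Real.log x ^ (16 - t) := by
    rw [← Real.rpow_neg hlog.le, hL16, ← Real.rpow_add hlog]; ring_nf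
  have hτ0 : 0 ≤ (Real.log x ^ t)⁻¹ := by positivity
  calc (Real.log x ^ t)⁻¹ * (κ₁ * x ^ (3 / 4 : ℝ) * S₃ + 9 * x ^ (1 / 4 : ℝ) * S₃')
      ≤ (Real.log x ^ t)⁻¹ * ((κ₁ * C₃ + 18 * C₃') * x ^ (3 / 4 : ℝ) * Real.log x ^ 16) :=
        mul_le_mul_of_nonneg_left h1 hτ0
    _ = (κ₁ * C₃ + 18 * C₃') * x ^ (3 / 4 : ℝ) * ((Real.log x ^ t)⁻¹ * Real.log x ^ 16) := by ring
    _ ≤ T := by rw [hτinv]; exact hxE1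

/-- `E₂` (the boundary `n`): `(κ₁ x^{3/4}/N + 9x^{1/4}) √(2θN+2) √S₄ ≤ T`. [folklore] -/
theorem err2_le {x A' κ₁ C₄' S₄ N T : ℝ} (hlog : 0 < Real.log x) (hx34 : 0 ≤ x ^ (3 / 4 : ℝ))
    (hx4 : 0 ≤ x ^ (1 / 4 : ℝ)) (hκ₁ : 0 ≤ κ₁) (hC₄' : 0 ≤ C₄') (hN : 0 < N)
    (hθN : 1 ≤ Real.log x ^ (-A') * N) (hS4 : S₄ ≤ 2 * C₄' * N * Real.log x ^ 32)
    (hx14N : x ^ (1 / 4 : ℝ) * N ≤ x ^ (3 / 4 : ℝ))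
    (hxE2 : Real.sqrt (8 * C₄') * (κ₁ + 9) * x ^ (3 / 4 : ℝ) * Real.log x ^ (-A' / 2 + 16) ≤ T) :
    (κ₁ * x ^ (3 / 4 : ℝ) / N + 9 * x ^ (1 / 4 : ℝ)) *
      (Real.sqrt (2 * Real.log x ^ (-A') * N + 2) * Real.sqrt S₄) ≤ T := by
  set θ := Real.log x ^ (-A') with hθ
  have hθpos : 0 < θ := Real.rpow_pos_of_pos hlog _
  have hL16 : Real.log x ^ 16 = Real.log x ^ (16 : ℝ) := (Real.rpow_natCast _ 16).symm.trans (by norm_num)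
  have h1 : Real.sqrt (2 * θ * N + 2) * Real.sqrt S₄ ≤
      Real.sqrt (8 * C₄') * Real.sqrt θ * N * Real.log x ^ 16 := by
    have ha : Real.sqrt (2 * θ * N + 2) ≤ Real.sqrt (4 * θ * N) := Real.sqrt_le_sqrt (by nlinarith)
    have hb : Real.sqrt S₄ ≤ Real.sqrt (2 * C₄' * N * Real.log x ^ 32) := Real.sqrt_le_sqrt hS4
    have hc : Real.sqrt (4 * θ * N) * Real.sqrt (2 * C₄' * N * Real.log x ^ 32) =
        Real.sqrt (8 * C₄') * Real.sqrt θ * N * Real.log x ^ 16 := by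
      rw [← Real.sqrt_mul (by positivity)]
      rw [show 4 * θ * N * (2 * C₄' * N * Real.log x ^ 32) =
        (Real.sqrt (8 * C₄') * Real.sqrt θ * N * Real.log x ^ 16) ^ 2 by
          rw [mul_pow, mul_pow, mul_pow, Real.sq_sqrt (by positivity), Real.sq_sqrt hθpos.le]; ring]
      exact Real.sqrt_sq (by positivity)
    calc Real.sqrt (2 * θ * N + 2) * Real.sqrt S₄
        ≤ Real.sqrt (4 * θ * N) * Real.sqrt (2 * C₄' * N * Real.log x ^ 32) :=
          mul_le_mul ha hb (Real.sqrt_nonneg _) (Real.sqrt_nonneg _)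
      _ = _ := hc
  have hsθ : Real.sqrt θ * Real.log x ^ 16 = Real.log x ^ (-A' / 2 + 16) := by
    rw [hθ, Real.sqrt_eq_rpow, ← Real.rpow_mul hlog.le, hL16, ← Real.rpow_add hlog]
    ring_nf
  have hpre : 0 ≤ κ₁ * x ^ (3 / 4 : ℝ) / N + 9 * x ^ (1 / 4 : ℝ) := by positivity
  calc (κ₁ * x ^ (3 / 4 : ℝ) / N + 9 * x ^ (1 / 4 : ℝ)) * (Real.sqrt (2 * θ * N + 2) * Real.sqrt S₄)
      ≤ (κ₁ * x ^ (3 / 4 : ℝ) / N + 9 * x ^ (1 / 4 : ℝ)) *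
          (Real.sqrt (8 * C₄') * Real.sqrt θ * N * Real.log x ^ 16) :=
        mul_le_mul_of_nonneg_left h1 hpre
    _ = Real.sqrt (8 * C₄') * (κ₁ * x ^ (3 / 4 : ℝ) + 9 * (x ^ (1 / 4 : ℝ) * N)) *
          (Real.sqrt θ * Real.log x ^ 16) := by
        field_simp
    _ ≤ Real.sqrt (8 * C₄') * (κ₁ * x ^ (3 / 4 : ℝ) + 9 * x ^ (3 / 4 : ℝ)) *
          (Real.sqrt θ * Real.log x ^ 16) := by gcongr
    _ = Real.sqrt (8 * C₄') * (κ₁ + 9) * x ^ (3 / 4 : ℝ) * Real.log x ^ (-A' / 2 + 16) := by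
        rw [hsθ]; ring
    _ ≤ T := hxE2

/-- `E₃` (the boundary `|mn - x| < θx`). [folklore] -/
theorem err3_le {x A' B κ C₂ C₂' S₂ S₂' N T : ℝ} (hlog : 0 < Real.log x) (hx34 : 0 ≤ x ^ (3 / 4 : ℝ))
    (hx4 : 0 ≤ x ^ (1 / 4 : ℝ)) (hκ : 0 ≤ κ) (hC₂' : 0 ≤ C₂')
    (hS2 : S₂ ≤ C₂ * Real.log x ^ 8) (hS2' : S₂' ≤ 2 * C₂' * N * Real.log x ^ 8)
    (hx14NB : x ^ (1 / 4 : ℝ) * N ≤ x ^ (3 / 4 : ℝ) * Real.log x ^ (-B))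
    (hxE3a : 3 * (4 * κ * C₂) * x ^ (3 / 4 : ℝ) * Real.log x ^ (-A' + 8) ≤ T)
    (hxE3b : 3 * (28 * C₂) * Real.sqrt x * Real.log x ^ 8 ≤ T)
    (hxE3c : 3 * (18 * C₂') * x ^ (3 / 4 : ℝ) * Real.log x ^ (-B + 8) ≤ T) :
    (4 * κ * Real.log x ^ (-A') * x ^ (3 / 4 : ℝ) + 28 * Real.sqrt x) * S₂ +
      9 * x ^ (1 / 4 : ℝ) * S₂' ≤ T := by
  set θ := Real.log x ^ (-A') with hθ
  have hθpos : 0 < θ := Real.rpow_pos_of_pos hlog _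
  have hL8 : Real.log x ^ 8 = Real.log x ^ (8 : ℝ) := (Real.rpow_natCast _ 8).symm.trans (by norm_num)
  have ha : (4 * κ * θ * x ^ (3 / 4 : ℝ) + 28 * Real.sqrt x) * S₂ ≤
      4 * κ * C₂ * (θ * x ^ (3 / 4 : ℝ) * Real.log x ^ 8) + 28 * C₂ * Real.sqrt x * Real.log x ^ 8 := by
    have := mul_le_mul_of_nonneg_left hS2
      (by positivity : 0 ≤ 4 * κ * θ * x ^ (3 / 4 : ℝ) + 28 * Real.sqrt x)
    nlinarith
  have hb : x ^ (1 / 4 : ℝ) * S₂' ≤ 2 * C₂' * (x ^ (3 / 4 : ℝ) * Real.log x ^ (-B)) * Real.log x ^ 8 := by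
    calc x ^ (1 / 4 : ℝ) * S₂' ≤ x ^ (1 / 4 : ℝ) * (2 * C₂' * N * Real.log x ^ 8) :=
          mul_le_mul_of_nonneg_left hS2' hx4
      _ = 2 * C₂' * (x ^ (1 / 4 : ℝ) * N) * Real.log x ^ 8 := by ring
      _ ≤ 2 * C₂' * (x ^ (3 / 4 : ℝ) * Real.log x ^ (-B)) * Real.log x ^ 8 := by gcongr
  have e1 : θ * x ^ (3 / 4 : ℝ) * Real.log x ^ 8 = x ^ (3 / 4 : ℝ) * Real.log x ^ (-A' + 8) := by
    rw [hθ, hL8, Real.rpow_add hlog]; ring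
  have e2 : 2 * C₂' * (x ^ (3 / 4 : ℝ) * Real.log x ^ (-B)) * Real.log x ^ 8 =
      2 * C₂' * (x ^ (3 / 4 : ℝ) * Real.log x ^ (-B + 8)) := by
    rw [hL8, Real.rpow_add hlog]; ring
  rw [e1] at ha
  rw [e2] at hb
  nlinarith [hxE3a, hxE3b, hxE3c]

/-- `E₄` (small `m`), with `y = 2x/2^J ≤ 4x/L₁`, `L₁ = (log x)^{2A+7}`. [folklore] -/
theorem err4_le {x A B κ₁ C₂ C₂' S₂ S₂' N T y : ℝ} (hlog : 0 < Real.log x) (hx0 : 0 < x)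
    (hκ₁ : 0 ≤ κ₁) (hC₂' : 0 ≤ C₂') (hS₂ : 0 ≤ S₂) (hS₂' : 0 ≤ S₂') (hy0 : 0 ≤ y)
    (hy2 : y ≤ 4 * x / Real.log x ^ (2 * A + 7))
    (hS2 : S₂ ≤ C₂ * Real.log x ^ 8) (hS2' : S₂' ≤ 2 * C₂' * N * Real.log x ^ 8)
    (hx14NB : x ^ (1 / 4 : ℝ) * N ≤ x ^ (3 / 4 : ℝ) * Real.log x ^ (-B))
    (hxE4a : 2 * (κ₁ * C₂ * 4) * x ^ (3 / 4 : ℝ) * Real.log x ^ ((2 * A + 7) * (-(3 / 4 : ℝ)) + 8) ≤ T)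
    (hxE4b : 2 * (72 * C₂') * x ^ (3 / 4 : ℝ) *
      Real.log x ^ ((2 * A + 7) * (-(1 / 4 : ℝ)) + -B + 8) ≤ T) :
    κ₁ * y ^ (3 / 4 : ℝ) * S₂ + 9 * y ^ (1 / 4 : ℝ) * S₂' ≤ T := by
  set L₁ := Real.log x ^ (2 * A + 7) with hL₁
  have hL₁0 : 0 < L₁ := Real.rpow_pos_of_pos hlog _
  have hL8 : Real.log x ^ 8 = Real.log x ^ (8 : ℝ) := (Real.rpow_natCast _ 8).symm.trans (by norm_num)
  have h4le : ∀ e : ℝ, e ≤ 1 → (4 : ℝ) ^ e ≤ 4 := fun e he =>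
    (Real.rpow_le_rpow_of_exponent_le (by norm_num) he).trans_eq (Real.rpow_one 4)
  have hye : ∀ e : ℝ, 0 ≤ e → e ≤ 1 →
      y ^ e ≤ 4 * x ^ e * Real.log x ^ ((2 * A + 7) * (-e)) := by
    intro e he0 he1
    calc y ^ e ≤ (4 * x / L₁) ^ e := Real.rpow_le_rpow hy0 hy2 he0
      _ = (4 : ℝ) ^ e * x ^ e * Real.log x ^ ((2 * A + 7) * (-e)) := by
          rw [Real.div_rpow (by positivity) hL₁0.le, Real.mul_rpow (by norm_num) hx0.le,
            hL₁, ← Real.rpow_mul hlog.le, div_eq_mul_inv, ← Real.rpow_neg hlog.le]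
          ring_nf
      _ ≤ 4 * x ^ e * Real.log x ^ ((2 * A + 7) * (-e)) := by
          gcongr
          exact h4le e he1
  have hy34 := hye (3 / 4) (by norm_num) (by norm_num)
  have hy14 := hye (1 / 4) (by norm_num) (by norm_num)
  have ha : κ₁ * y ^ (3 / 4 : ℝ) * S₂ ≤
      κ₁ * C₂ * 4 * x ^ (3 / 4 : ℝ) * Real.log x ^ ((2 * A + 7) * (-(3 / 4 : ℝ)) + 8) := by
    calc κ₁ * y ^ (3 / 4 : ℝ) * S₂
        ≤ κ₁ * (4 * x ^ (3 / 4 : ℝ) * Real.log x ^ ((2 * A + 7) * (-(3 / 4 : ℝ)))) *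
            (C₂ * Real.log x ^ 8) :=
          mul_le_mul (mul_le_mul_of_nonneg_left hy34 hκ₁) hS2 hS₂ (by positivity)
      _ = κ₁ * C₂ * 4 * x ^ (3 / 4 : ℝ) *
            (Real.log x ^ ((2 * A + 7) * (-(3 / 4 : ℝ))) * Real.log x ^ 8) := by ring
      _ = _ := by rw [hL8, ← Real.rpow_add hlog]
  have hb : 9 * y ^ (1 / 4 : ℝ) * S₂' ≤
      72 * C₂' * x ^ (3 / 4 : ℝ) * Real.log x ^ ((2 * A + 7) * (-(1 / 4 : ℝ)) + -B + 8) := by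
    calc 9 * y ^ (1 / 4 : ℝ) * S₂'
        ≤ 9 * (4 * x ^ (1 / 4 : ℝ) * Real.log x ^ ((2 * A + 7) * (-(1 / 4 : ℝ)))) *
            (2 * C₂' * N * Real.log x ^ 8) :=
          mul_le_mul (mul_le_mul_of_nonneg_left hy14 (by norm_num)) hS2' hS₂' (by positivity)
      _ = 72 * C₂' * (x ^ (1 / 4 : ℝ) * N) * Real.log x ^ ((2 * A + 7) * (-(1 / 4 : ℝ))) *
            Real.log x ^ 8 := by ring
      _ ≤ 72 * C₂' * (x ^ (3 / 4 : ℝ) * Real.log x ^ (-B)) * Real.log x ^ ((2 * A + 7) * (-(1 / 4 : ℝ))) *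
            Real.log x ^ 8 := by gcongr
      _ = 72 * C₂' * x ^ (3 / 4 : ℝ) * (Real.log x ^ ((2 * A + 7) * (-(1 / 4 : ℝ))) *
            Real.log x ^ (-B) * Real.log x ^ 8) := by ring
      _ = _ := by rw [hL8, ← Real.rpow_add hlog, ← Real.rpow_add hlog]
  nlinarith [hxE4a, hxE4b]

/-! ### Proposition 4.1 from (4.23) -/

/-- `log 16 > 2`. [folklore] -/
theorem two_lt_log_sixteen : (2 : ℝ) < Real.log 16 := by
  have h1 : Real.exp 2 < 16 := by
    have h := Real.exp_one_lt_d9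
    have h2 : Real.exp 2 = Real.exp 1 * Real.exp 1 := by rw [← Real.exp_add]; norm_num
    rw [h2]; nlinarith [Real.exp_pos 1]
  calc (2 : ℝ) = Real.log (Real.exp 2) := (Real.log_exp 2).symm
    _ < Real.log 16 := Real.log_lt_log (Real.exp_pos 2) h1

/-- The point estimate: at an `x ≥ 16` where (4.23) holds in the shape `BilinBoundAt` and the seven
asymptotic comparisons hold, `B(x; N) ≤ (48 M_ψ K₀ + 7) x^{3/4} (log x)^{4-A}` for every `N` in
`[x^{1/4}, x^{1/2}(log x)^{-B}]`. [cite: FriedlanderIwaniecAnnals1998, Proposition 4.1] -/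
theorem fiBilinearPi_le_at {x P N C A A' t B K₀ Mψ C₃ C₃' C₂ C₂' C₄' : ℝ}
    (hB : BilinBoundAt x P N C (2 * A + 8) (Real.log x ^ (-A')) (Real.log x ^ t) (Real.log x ^ (-A)) K₀)
    (hMψ : 1 ≤ Mψ) (hM' : ∀ s, |deriv Real.smoothTransition s| ≤ Mψ)
    (hM'' : ∀ s, |deriv (deriv Real.smoothTransition) s| ≤ Mψ) (hK₀ : 0 ≤ K₀) (hA : 0 < A) (hB0 : 0 ≤ B)
    (hC₃ : ∀ y : ℝ, 2 ≤ y → ∑ n ∈ Icc 1 ⌊y⌋₊, ((σ 0 n : ℕ) : ℝ) ^ 3 / n ≤ C₃ * Real.log y ^ (2 ^ (3 + 1)))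
    (hC₃' : ∀ y : ℝ, 2 ≤ y → ∑ n ∈ Icc 1 ⌊y⌋₊, ((σ 0 n : ℕ) : ℝ) ^ 3 ≤ C₃' * y * Real.log y ^ (2 ^ (3 + 1)))
    (hC₂ : ∀ y : ℝ, 2 ≤ y → ∑ n ∈ Icc 1 ⌊y⌋₊, ((σ 0 n : ℕ) : ℝ) ^ 2 / n ≤ C₂ * Real.log y ^ (2 ^ (2 + 1)))
    (hC₂' : ∀ y : ℝ, 2 ≤ y → ∑ n ∈ Icc 1 ⌊y⌋₊, ((σ 0 n : ℕ) : ℝ) ^ 2 ≤ C₂' * y * Real.log y ^ (2 ^ (2 + 1)))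
    (hC₄' : ∀ y : ℝ, 2 ≤ y → ∑ n ∈ Icc 1 ⌊y⌋₊, ((σ 0 n : ℕ) : ℝ) ^ 4 ≤ C₄' * y * Real.log y ^ (2 ^ (4 + 1)))
    (hC₃0 : 0 ≤ C₃) (hC₃'0 : 0 ≤ C₃') (hC₂0 : 0 ≤ C₂) (hC₂'0 : 0 ≤ C₂') (hC₄'0 : 0 ≤ C₄')
    (hx16 : 16 ≤ x) (hxθ : 2 ≤ Real.log x ^ A') (hxθN : Real.log x ^ A' ≤ x ^ (1 / 4 : ℝ))
    (hxA : Real.log x ^ (2 * A + 8) ≤ x)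
    (hxE1 : ((4 * friedlanderIwaniecKappa + 14) * C₃ + 18 * C₃') * x ^ (3 / 4 : ℝ) *
      Real.log x ^ (16 - t) ≤ x ^ (3 / 4 : ℝ) * Real.log x ^ (4 - A))
    (hxE2 : Real.sqrt (8 * C₄') * ((4 * friedlanderIwaniecKappa + 14) + 9) * x ^ (3 / 4 : ℝ) *
      Real.log x ^ (-A' / 2 + 16) ≤ x ^ (3 / 4 : ℝ) * Real.log x ^ (4 - A))
    (hxE3a : 3 * (4 * friedlanderIwaniecKappa * C₂) * x ^ (3 / 4 : ℝ) * Real.log x ^ (-A' + 8) ≤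
      x ^ (3 / 4 : ℝ) * Real.log x ^ (4 - A))
    (hxE3b : 3 * (28 * C₂) * Real.sqrt x * Real.log x ^ 8 ≤ x ^ (3 / 4 : ℝ) * Real.log x ^ (4 - A))
    (hxE3c : 3 * (18 * C₂') * x ^ (3 / 4 : ℝ) * Real.log x ^ (-B + 8) ≤
      x ^ (3 / 4 : ℝ) * Real.log x ^ (4 - A))
    (hxE4a : 2 * ((4 * friedlanderIwaniecKappa + 14) * C₂ * 4) * x ^ (3 / 4 : ℝ) *
      Real.log x ^ ((2 * A + 7) * (-(3 / 4 : ℝ)) + 8) ≤ x ^ (3 / 4 : ℝ) * Real.log x ^ (4 - A))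
    (hxE4b : 2 * (72 * C₂') * x ^ (3 / 4 : ℝ) *
      Real.log x ^ ((2 * A + 7) * (-(1 / 4 : ℝ)) + -B + 8) ≤ x ^ (3 / 4 : ℝ) * Real.log x ^ (4 - A))
    (hx14 : x ^ (1 / 4 : ℝ) ≤ N) (hN2 : N ≤ x ^ (1 / 2 : ℝ) / Real.log x ^ B) :
    fiSieveSeq.fiBilinearPi x N C P ≤ (48 * Mψ * K₀ + 7) * (x ^ (3 / 4 : ℝ) * Real.log x ^ (4 - A)) := by
  have hκ := friedlanderIwaniecKappa_pos
  have hMψ0 : 0 ≤ Mψ := by linarith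
  have hx0 : 0 < x := by linarith
  have hx1 : 1 < x := by linarith
  have hlog : 0 < Real.log x := Real.log_pos hx1
  have hlog2 : 2 < Real.log x := two_lt_log_sixteen.trans_le (Real.log_le_log (by norm_num) hx16)
  have hlog1 : 1 ≤ Real.log x := by linarith
  have hθpos : 0 < Real.log x ^ (-A') := Real.rpow_pos_of_pos hlog _
  have hθ_eq : Real.log x ^ (-A') = (Real.log x ^ A')⁻¹ := Real.rpow_neg hlog.le A'
  have hθ2 : Real.log x ^ (-A') ≤ 1 / 2 := by
    rw [hθ_eq, inv_le_comm₀ (by positivity) (by norm_num)]; linarith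
  have hτpos : 0 < Real.log x ^ t := Real.rpow_pos_of_pos hlog _
  have hϑ0 : 0 ≤ Real.log x ^ (-A) := (Real.rpow_pos_of_pos hlog _).le
  -- facts about `N`
  have hx14' : 1 ≤ x ^ (1 / 4 : ℝ) := Real.one_le_rpow hx1.le (by norm_num)
  have hN1' : 1 ≤ N := hx14'.trans hx14
  have hNpos : 0 < N := by linarith
  have hlogB : 1 ≤ Real.log x ^ B := Real.one_le_rpow hlog1 hB0
  have hsqrt : Real.sqrt x = x ^ (1 / 2 : ℝ) := Real.sqrt_eq_rpow x
  have hNB : N * Real.log x ^ B ≤ Real.sqrt x := by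
    rw [hsqrt]; exact (le_div_iff₀ (by positivity)).mp hN2
  have hNsqrt : N ≤ Real.sqrt x := by
    calc N = N * 1 := (mul_one N).symm
      _ ≤ N * Real.log x ^ B := mul_le_mul_of_nonneg_left hlogB hNpos.le
      _ ≤ Real.sqrt x := hNB
  have h2N : 2 * N ≤ x := by
    have hs : Real.sqrt x * Real.sqrt x = x := Real.mul_self_sqrt hx0.le
    have hs2 : 2 ≤ Real.sqrt x := by
      rw [show (2 : ℝ) = Real.sqrt 4 by
        rw [show (4 : ℝ) = 2 ^ 2 by norm_num, Real.sqrt_sq (by norm_num)]]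
      exact Real.sqrt_le_sqrt (by linarith)
    calc 2 * N ≤ 2 * Real.sqrt x := by linarith
      _ ≤ Real.sqrt x * Real.sqrt x := mul_le_mul_of_nonneg_right hs2 (Real.sqrt_nonneg x)
      _ = x := hs
  have hθN : 1 ≤ Real.log x ^ (-A') * N := by
    rw [hθ_eq]
    have hpos : 0 < Real.log x ^ A' := by positivity
    calc (1 : ℝ) = (Real.log x ^ A')⁻¹ * Real.log x ^ A' := by field_simp
      _ ≤ (Real.log x ^ A')⁻¹ * N := mul_le_mul_of_nonneg_left (hxθN.trans hx14) (by positivity)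
  have hx14N : x ^ (1 / 4 : ℝ) * N ≤ x ^ (3 / 4 : ℝ) := by
    calc x ^ (1 / 4 : ℝ) * N ≤ x ^ (1 / 4 : ℝ) * Real.sqrt x :=
          mul_le_mul_of_nonneg_left hNsqrt (by positivity)
      _ = x ^ (3 / 4 : ℝ) := by rw [hsqrt, ← Real.rpow_add hx0]; norm_num
  have hx14NB : x ^ (1 / 4 : ℝ) * N ≤ x ^ (3 / 4 : ℝ) * Real.log x ^ (-B) := by
    rw [Real.rpow_neg hlog.le, ← div_eq_mul_inv, le_div_iff₀ (by positivity)]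
    calc x ^ (1 / 4 : ℝ) * N * Real.log x ^ B = x ^ (1 / 4 : ℝ) * (N * Real.log x ^ B) := by ring
      _ ≤ x ^ (1 / 4 : ℝ) * Real.sqrt x := mul_le_mul_of_nonneg_left hNB (by positivity)
      _ = x ^ (3 / 4 : ℝ) := by rw [hsqrt, ← Real.rpow_add hx0]; norm_num
  -- `x (log x)^{-2A-8} ≥ 1` and the dyadic depth `J`
  have hxA' : 1 ≤ x / Real.log x ^ (2 * A + 8) := by
    rw [le_div_iff₀ (by positivity)]; linarith
  have hL₁1 : 1 ≤ Real.log x ^ (2 * A + 7) := Real.one_le_rpow hlog1 (by linarith)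
  have hL₁pos : 0 < Real.log x ^ (2 * A + 7) := by linarith
  obtain ⟨J, hJ1, hJ2⟩ := exists_nat_pow_near hL₁1 one_lt_two
  have hL₁x : Real.log x ^ (2 * A + 7) * Real.log x = Real.log x ^ (2 * A + 8) := by
    rw [← Real.rpow_add_one hlog.ne']; ring_nf
  have hJ : x / Real.log x ^ (2 * A + 8) < x / 2 ^ (J + 1) := by
    apply div_lt_div_of_pos_left hx0 (by positivity)
    calc (2 : ℝ) ^ (J + 1) = 2 * 2 ^ J := by ring
      _ ≤ 2 * Real.log x ^ (2 * A + 7) := by linarith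
      _ = Real.log x ^ (2 * A + 7) * 2 := by ring
      _ < Real.log x ^ (2 * A + 7) * Real.log x := mul_lt_mul_of_pos_left hlog2 hL₁pos
      _ = _ := hL₁x
  have hL₁x' : Real.log x ^ (2 * A + 7) ≤ x := by
    calc Real.log x ^ (2 * A + 7) ≤ Real.log x ^ (2 * A + 7) * Real.log x :=
          le_mul_of_one_le_right hL₁pos.le hlog1
      _ = Real.log x ^ (2 * A + 8) := hL₁x
      _ ≤ x := hxA
  have hy1 : 1 ≤ 2 * x / 2 ^ J := by
    rw [le_div_iff₀ (by positivity)]; linarith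
  have hy0 : 0 ≤ 2 * x / 2 ^ J := by positivity
  have hy2 : 2 * x / 2 ^ J ≤ 4 * x / Real.log x ^ (2 * A + 7) := by
    rw [div_le_div_iff₀ (by positivity) hL₁pos]
    have h22 : Real.log x ^ (2 * A + 7) ≤ 2 * 2 ^ J := by rw [pow_succ] at hJ2; linarith
    calc 2 * x * Real.log x ^ (2 * A + 7) ≤ 2 * x * (2 * 2 ^ J) :=
          mul_le_mul_of_nonneg_left h22 (by positivity)
      _ = 4 * x * 2 ^ J := by ring
  -- the master inequality
  have hMst := fiBilinearPi_le_master hB hMψ hM' hM'' hNpos hθpos hθ2 hτpos hϑ0 hK₀ (by linarith)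
    hxA' hJ hy1
  -- divisor sums
  have hS3 := sum_Ioc_sigma_pow_div_le hC₃ hN1' h2N hC₃0
  have hS3' := sum_Ioc_sigma_pow_le hC₃' hN1' h2N hC₃'0
  have hS2 := sum_Ioc_sigma_pow_div_le hC₂ hN1' h2N hC₂0
  have hS2' := sum_Ioc_sigma_pow_le hC₂' hN1' h2N hC₂'0
  have hS4 := sum_Icc_sigma_pow_le hC₄' hN1' h2N hC₄'0
  norm_num at hS3 hS3' hS2 hS2' hS4
  have hx34 : 0 ≤ x ^ (3 / 4 : ℝ) := by positivity
  have hx4 : 0 ≤ x ^ (1 / 4 : ℝ) := by positivity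
  have hκ₁ : 0 ≤ 4 * friedlanderIwaniecKappa + 14 := by positivity
  have hS₂0 : 0 ≤ ∑ n ∈ Ioc ⌊N⌋₊ ⌊2 * N⌋₊, ((σ 0 n : ℕ) : ℝ) ^ 2 / n :=
    sum_nonneg fun _ _ => by positivity
  have hS₂'0 : 0 ≤ ∑ n ∈ Ioc ⌊N⌋₊ ⌊2 * N⌋₊, ((σ 0 n : ℕ) : ℝ) ^ 2 :=
    sum_nonneg fun _ _ => by positivity
  -- the four error terms and the main term
  have hE1 := err1_le hlog hx34 hx4 hκ₁ hC₃'0 hS3 hS3' hx14N hxE1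
  have hE2 := err2_le hlog hx34 hx4 hκ₁ hC₄'0 hNpos hθN hS4 hx14N hxE2
  have hE3 := err3_le hlog hx34 hx4 hκ.le hC₂'0 hS2 hS2' hx14NB hxE3a hxE3b hxE3c
  have hE4 := err4_le hlog hx0 hκ₁ hC₂'0 hS₂0 hS₂'0 hy0 hy2 hS2 hS2' hx14NB hxE4a hxE4b
  have hMain : 48 * Mψ * K₀ * Real.log x ^ (-A) * x ^ (3 / 4 : ℝ) * Real.log x ^ 4 =
      48 * Mψ * K₀ * (x ^ (3 / 4 : ℝ) * Real.log x ^ (4 - A)) := by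
    have hL4 : Real.log x ^ 4 = Real.log x ^ (4 : ℝ) := (Real.rpow_natCast _ 4).symm.trans (by norm_num)
    have : Real.log x ^ (-A) * Real.log x ^ 4 = Real.log x ^ (4 - A) := by
      rw [hL4, ← Real.rpow_add hlog]; ring_nf
    calc 48 * Mψ * K₀ * Real.log x ^ (-A) * x ^ (3 / 4 : ℝ) * Real.log x ^ 4
        = 48 * Mψ * K₀ * (x ^ (3 / 4 : ℝ) * (Real.log x ^ (-A) * Real.log x ^ 4)) := by ring
      _ = _ := by rw [this]
  have hT0 : 0 ≤ x ^ (3 / 4 : ℝ) * Real.log x ^ (4 - A) := by positivity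
  have h48 : 0 ≤ 48 * Mψ * K₀ := by positivity
  linarith [hMst, hE1, hE2, hE3, hE4, hMain]

end FriedlanderIwaniecPrimes

open FriedlanderIwaniecPrimes

/-- **FI Proposition 4.1 from (4.23)** (the content of §4 of the source): the bilinear form bound
(4.5) `B(x; N) ≪ A(x)(log x)^{4-A}` in the ranges (4.4), (4.6), `1 ≤ C ≤ N^{1-η}` follows from the
bound (4.23) for the forms `B*(M, N)` — the hypothesis `h`: for every `η > 0`, `A > 0` there are
`A' ≥ 2A + 2^20`, `t ≥ A + 124`, `B > 0`, `K > 0` with, for all large `x`, all `P` in (4.4), `N` in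
(4.6), `1 ≤ C ≤ N^{1-η}`, `BilinBoundAt x P N C (2A+8) (log x)^{-A'} (log x)^t (log x)^{-A} K`
((4.23) in the range `x(log x)^{-2A-8} < MN < x`; see the module docstring for this range versus the
printed (4.19)) — via (4.9)–(4.19): removal of `τ(n) > τ`, the smooth partition (4.12)–(4.14), the
boundary terms, the dyadic split (4.18) and the terms with small `m`, all estimated trivially
(`FriedlanderIwaniecPrimesBilinearCounting`), and `A(x) ≥ 2κ x^{3/4}` ((4.2), proved in the tree).
(4.23) is proved in §§5–26 of the source and is assumed here, not vendored as a named fact.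
[cite: FriedlanderIwaniecAnnals1998, Proposition 4.1 and §4 (4.9)-(4.23)] -/
theorem FriedlanderIwaniec1998_prop41_of_bilinear423
    (h : ∀ η : ℝ, 0 < η → ∀ A : ℝ, 0 < A →
      ∃ A' t B K : ℝ, 2 * A + 2 ^ 20 ≤ A' ∧ A + 124 ≤ t ∧ 0 < B ∧ 0 < K ∧
      ∀ᶠ x : ℝ in atTop,
        ∀ P : ℝ, Real.log (Real.log x) ^ 2 ≤ Real.log P →
          Real.log P ≤ Real.log x * (Real.log (Real.log x))⁻¹ ^ 2 →
        ∀ N : ℝ, x ^ (1 / 4 + η : ℝ) < N → N < x ^ (1 / 2 : ℝ) / Real.log x ^ B →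
        ∀ C : ℝ, 1 ≤ C → C ≤ N ^ (1 - η : ℝ) →
          BilinBoundAt x P N C (2 * A + 8) (Real.log x ^ (-A')) (Real.log x ^ t)
            (Real.log x ^ (-A)) K) :
    FriedlanderIwaniec1998_prop41 := by
  intro η hη A hA
  obtain ⟨A', t, B₀, K₀, hA', ht, hB₀, hK₀, hfact⟩ := h η hη A hA
  obtain ⟨Mψ, hMψ, hM', hM''⟩ := exists_bound_deriv_smoothTransition
  obtain ⟨C₃, hC₃0, hC₃⟩ := exists_sum_sigma_zero_pow_div_le_real 3
  obtain ⟨C₃', hC₃'0, hC₃'⟩ := exists_sum_sigma_zero_pow_le_real 3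
  obtain ⟨C₂, hC₂0, hC₂⟩ := exists_sum_sigma_zero_pow_div_le_real 2
  obtain ⟨C₂', hC₂'0, hC₂'⟩ := exists_sum_sigma_zero_pow_le_real 2
  obtain ⟨C₄', hC₄'0, hC₄'⟩ := exists_sum_sigma_zero_pow_le_real 4
  have hκ := friedlanderIwaniecKappa_pos
  have hMψ0 : 0 ≤ Mψ := by linarith
  refine ⟨max B₀ (A + 10), lt_max_of_lt_left hB₀,
    (48 * Mψ * K₀ + 7) / (2 * friedlanderIwaniecKappa), ?_⟩
  have hBB₀ : B₀ ≤ max B₀ (A + 10) := le_max_left _ _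
  have hBA : A + 10 ≤ max B₀ (A + 10) := le_max_right _ _
  -- eventualities, all independent of `N`
  have ev_θ := eventually_mul_log_rpow_le (e₁ := 0) (e₂ := A') (by linarith) 2
  have ev_θN := eventually_mul_log_rpow_le_rpow A' (by norm_num : (0 : ℝ) < 1 / 4) 1
  have ev_xA := eventually_mul_log_rpow_le_rpow (2 * A + 8) one_pos 1
  have ev_E1 := eventually_le_target (e := 16 - t) (A := A) (by linarith)
    ((4 * friedlanderIwaniecKappa + 14) * C₃ + 18 * C₃')
  have ev_E2 := eventually_le_target (e := -A' / 2 + 16) (A := A) (by linarith)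
    (Real.sqrt (8 * C₄') * ((4 * friedlanderIwaniecKappa + 14) + 9))
  have ev_E3a := eventually_le_target (e := -A' + 8) (A := A) (by linarith)
    (3 * (4 * friedlanderIwaniecKappa * C₂))
  have ev_E3b := eventually_sqrt_le_target A (3 * (28 * C₂))
  have ev_E3c := eventually_le_target (e := -max B₀ (A + 10) + 8) (A := A) (by linarith)
    (3 * (18 * C₂'))
  have ev_E4a := eventually_le_target (e := (2 * A + 7) * (-(3 / 4 : ℝ)) + 8) (A := A) (by nlinarith)
    (2 * ((4 * friedlanderIwaniecKappa + 14) * C₂ * 4))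
  have ev_E4b := eventually_le_target (e := (2 * A + 7) * (-(1 / 4 : ℝ)) + -max B₀ (A + 10) + 8)
    (A := A) (by nlinarith) (2 * (72 * C₂'))
  filter_upwards [hfact, fiCount_bounds FriedlanderIwaniec1998_count_asymp_holds, ev_θ, ev_θN, ev_xA,
    ev_E1, ev_E2, ev_E3a, ev_E3b, ev_E3c, ev_E4a, ev_E4b, eventually_ge_atTop (16 : ℝ)]
    with x hfx hcnt hxθ hxθN hxA hxE1 hxE2 hxE3a hxE3b hxE3c hxE4a hxE4b hx16
  intro P hP1 hP2 N hN1 hN2 C hC1 hC2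
  rw [Real.rpow_zero, mul_one] at hxθ
  rw [one_mul] at hxθN
  rw [one_mul, Real.rpow_one] at hxA
  have hx1 : 1 < x := by linarith
  have hlog1 : 1 ≤ Real.log x :=
    le_of_lt (one_lt_two.trans (two_lt_log_sixteen.trans_le (Real.log_le_log (by norm_num) hx16)))
  -- the `N`-range of the fact and the fact at `x`
  have hN2' : N < x ^ (1 / 2 : ℝ) / Real.log x ^ B₀ :=
    lt_of_lt_of_le hN2 (div_le_div_of_nonneg_left (by positivity) (by positivity)
      (Real.rpow_le_rpow_of_exponent_le hlog1 hBB₀))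
  have hBat : BilinBoundAt x P N C (2 * A + 8) (Real.log x ^ (-A')) (Real.log x ^ t)
      (Real.log x ^ (-A)) K₀ :=
    hfx P hP1 hP2 N hN1 hN2' C hC1 hC2
  have hx14 : x ^ (1 / 4 : ℝ) ≤ N :=
    ((Real.rpow_le_rpow_of_exponent_le hx1.le (by linarith)).trans hN1.le)
  have hAt := fiBilinearPi_le_at hBat hMψ hM' hM'' hK₀.le hA (by linarith) hC₃ hC₃' hC₂ hC₂' hC₄'
    hC₃0.le hC₃'0.le hC₂0.le hC₂'0.le hC₄'0.le hx16 hxθ hxθN hxA hxE1 hxE2 hxE3a hxE3b hxE3c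
    hxE4a hxE4b hx14 hN2.le
  -- `x^{3/4} ≤ A(x)/(2κ)`
  have hTA : x ^ (3 / 4 : ℝ) * Real.log x ^ (4 - A) ≤
      fiCount x * Real.log x ^ (4 - A) / (2 * friedlanderIwaniecKappa) := by
    rw [le_div_iff₀ (by positivity)]
    have hl : 0 ≤ Real.log x ^ (4 - A) := by positivity
    nlinarith [hcnt.1]
  calc fiSieveSeq.fiBilinearPi x N C P ≤ (48 * Mψ * K₀ + 7) * (x ^ (3 / 4 : ℝ) * Real.log x ^ (4 - A)) := hAt
    _ ≤ (48 * Mψ * K₀ + 7) * (fiCount x * Real.log x ^ (4 - A) / (2 * friedlanderIwaniecKappa)) :=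
        mul_le_mul_of_nonneg_left hTA (by positivity)
    _ = (48 * Mψ * K₀ + 7) / (2 * friedlanderIwaniecKappa) * fiCount x * Real.log x ^ (4 - A) := by
        ring

end Literature.NumberTheory.Sieve
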